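import Literature.Topology.FourManifolds.TubeLinearReframe
import Literature.Topology.FourManifolds.GompfSectionCircleFramings
import Literature.Topology.FourManifolds.CircleLoops
import Literature.Topology.FourManifolds.GompfConjInvariance
import Literature.Topology.FourManifolds.SphereMapsMissPoints
import Literature.Topology.FourManifolds.CircleNbhdFraming
import Mathlib.Analysis.Normed.Module.Connected
import HarnessLib

/-!
# A circle in a 4-manifold has at most two framings: smooth loops `𝕊¹ → GL⁺(3, ℝ)` are joined
# to the identity loop or to the twist (`π₁ SO(3) = ℤ/2`)

Topic `Literature/Topology/FourManifolds` (fact seat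
`provefact-Literature.Topology.FourManifolds.exists-9b5372b6c2`, towards Kirby 1989, Ch. X p. 55:
*"The framing is zero in `π₁(SO(3)) = ℤ/2` …"*).  Gompf–Stipsicz, *4-Manifolds and Kirby
Calculus* (1999), §5.2: surgery on a circle in a `4`-manifold requires a framing of its normal
bundle, and *"there are two possible framings, since `π₁(SO(3)) ≅ ℤ₂`"*.  The tree reduces the
comparison of two surgeries along the same circle to a smooth loop of fibre operators
(`Literature.Topology.FourManifolds.CircleNbhd.exists_opLoop_nonempty_diffeomorph_surgered`,
`CircleNbhdFraming.lean`) and identifies the surgeries along the two ends of a continuous family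
of smooth loops (`CircleNbhd.nonempty_diffeomorph_surgered_linTwist_of_family`,
`TubeLinearReframe.lean`); `GompfSectionCircleFramings.lean` reduces to loops of positive
determinant (`OpLoop.exists_det_pos`).  This file supplies the missing classification of such
loops and draws the conclusion.

## Main results (everything proved; no named facts)

* `OpLoop.Joined` — the two ends of a family of smooth loops with jointly continuous operators and
  inverses (exactly the hypothesis of the family lemma); an equivalence relation compatible with
  pointwise products (`OpLoop.mul`); `OpLoop.joined_of_family` — inverses come for free along a
  family of unit-valued loops (`Ring.inverse` is smooth and continuous at units);
* `OpLoop.twist` — one full turn of the plane `⟨e₀, e₁⟩` about `e₂` (linear in `u ∈ 𝕊¹`);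
* **`OpLoop.exists_joined_one_or_twist`** — every smooth loop `L : 𝕊¹ → GL(3, ℝ)` with
  `det L > 0` is joined to `1` or to `twist`;
* `CircleNbhd.nonempty_diffeomorph_surgered_linTwist(_of_det_pos)` and
  **`CircleNbhd.nonempty_diffeomorph_surgered_or_twist`** — for any two tubular neighbourhoods
  `ν₀`, `ν` of the same circle in a smooth `4`-manifold, `ν.Surgered ≃ₘ ν₀.Surgered` or
  `ν.Surgered ≃ₘ (ν₀.linTwist twist).Surgered`.

## The proof of the classification (elementary, explicit families)

* **A.** The third column `a(u) = L_u e₂` has a direction `x : 𝕊¹ → 𝕊²`, a smooth curve, which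
  misses a point `m` (`SphereMapsMissPoints.lean`); the segment from `x(u)` to `-m` never vanishes
  and is never antipodal to `x(u)`, so the rotation `hh(x + x_t) ∘ hh(x)` (two Householder
  reflections, `OpLoop.hh`) turns `x(u)` to the segment direction `x_t(u)`; at `t = 1` the third
  columns point along `-m`, and one or two more such moves make them positive multiples of `e₂`
  (`exists_joined_col_e2`).
* **B.** Column operations by explicit units: scale the third column to `e₂`
  (`scaleOp`), then shear away the `e₂`-components of the first two columns (`shearK`, square
  zero) — block form (`exists_joined_block`).
* **C.** In the horizontal block, orthogonalise the second column against the first (`colShear`)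
  and scale both columns (`scaleE`); positivity of the determinant — preserved along families
  (`Joined.det_pos`, intermediate value theorem) and all around the circle
  (`det_pos_of_det_pos_ptA`, connectedness) and read off the block (`det_block`) — makes the
  second column `+J` of the first, so the loop becomes the rotation loop `rotLoop f` of a smooth
  `f : 𝕊¹ → S¹ ⊆ ℂ` (`exists_joined_rotLoop`).
* **D.** Lift the angle of `f ∘ circlePoint` (`CircleAngleLift.lean`): `α(φ + 2π) = α(φ) + 2πd`;
  the interpolation `(1-t)α + t(dφ + α(0))` has the same period defect at every stage, so it
  descends to the circle (`descend`, `CircleLoops.lean`) and joins `rotLoop f` to the `d`-fold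
  twist times a constant phase, which is turned back to `1` (`exists_joined_rotLoop_twistPow`).
* **E.** `twist² ∼ 1` by quaternions: the matrices `M(q)` of `v ↦ q v q̄` (polynomial entries,
  `M(q)M(q̄) = |q|⁴`) along `q_t(u) = (1-t)(u₀ + u₁k) + t j`, never zero, join the doubled twist
  `M(u₀ + u₁ k) = rot(u)²` to the constant half turn `M(j)`, which rotates back to `1`
  (`joined_twist_mul_twist_one`); hence every power of the twist is joined to `1` or `twist` by
  parity (`joined_twistPow`).

## References

* R. E. Gompf, A. I. Stipsicz, *4-Manifolds and Kirby Calculus*, GSM 20 (1999), §5.2.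
  [GompfStipsiczGSM1999]
* R. C. Kirby, *The Topology of 4-Manifolds*, LNM 1374 (1989), Ch. X p. 55. [Kirby1989]
* A. Kosinski, *Differential Manifolds* (1993), Ch. III §3. [Kosinski1993]
* M. W. Hirsch, *Differential Topology* (1976), Ch. 3 §1 (a smooth curve misses points of `S²`).
  [HirschDT1976]
-/

open scoped Manifold ContDiff Topology
open Set Function Filter Metric

noncomputable section

namespace Literature.Topology.FourManifolds

universe u

/-- Local notation: `𝔼 n` is the model Euclidean space `EuclideanSpace ℝ (Fin n)`. -/
local notation "𝔼 " n:arg => EuclideanSpace ℝ (Fin n)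

/-- Local notation: `𝕊 n` is the unit sphere in `EuclideanSpace ℝ (Fin (n + 1))`. -/
local notation "𝕊 " n:arg => (Metric.sphere (0 : EuclideanSpace ℝ (Fin (n + 1))) 1)

namespace OpLoop

/-! ### Products of loops -/

/-- **Pointwise product of two loops of invertible operators.** [folklore] -/
def mul (L L' : OpLoop) : OpLoop where
  toFun u := L.toFun u * L'.toFun u
  inv u := L'.inv u * L.inv u
  contMDiff_toFun := (contDiff_mul (𝔸 := 𝔼 3 →L[ℝ] 𝔼 3) (n := ∞)).comp_contMDiff
    (L.contMDiff_toFun.prodMk_space L'.contMDiff_toFun)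
  contMDiff_inv := (contDiff_mul (𝔸 := 𝔼 3 →L[ℝ] 𝔼 3) (n := ∞)).comp_contMDiff
    (L'.contMDiff_inv.prodMk_space L.contMDiff_inv)
  mul_inv u := by rw [mul_assoc, ← mul_assoc (L'.toFun u), L'.mul_inv, one_mul, L.mul_inv]
  inv_mul u := by rw [mul_assoc, ← mul_assoc (L.inv u), L.inv_mul, one_mul, L'.inv_mul]

/-- The product evaluated. [folklore] -/
@[simp] theorem mul_toFun (L L' : OpLoop) (u : 𝕊 1) : (L.mul L').toFun u = L.toFun u * L'.toFun u := rfl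

/-- The inverse of the product evaluated. [folklore] -/
@[simp] theorem mul_inv_apply (L L' : OpLoop) (u : 𝕊 1) : (L.mul L').inv u = L'.inv u * L.inv u := rfl

/-- `one * L = L`. [folklore] -/
theorem one_mul (L : OpLoop) : one.mul L = L := by
  cases L; simp only [mul, one, _root_.one_mul, _root_.mul_one]

/-- `L * one = L`. [folklore] -/
theorem mul_one (L : OpLoop) : L.mul one = L := by
  cases L; simp only [mul, one, _root_.one_mul, _root_.mul_one]

/-! ### Joined loops: the two ends of a continuous family of smooth loops -/

/-- **Two loops are joined** if they are the ends `F 0`, `F 1` of a family `t ↦ F t` of smooth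
loops whose operators and inverses depend continuously on `(t, u) ∈ [0, 1] × 𝕊¹` — exactly the
hypothesis of `Literature.Topology.FourManifolds.CircleNbhd.nonempty_diffeomorphic_surgered_linTwist_of_family`,
under which the surgeries along `ν.linTwist (F 0)` and `ν.linTwist (F 1)` are diffeomorphic
(Gompf–Stipsicz, *4-Manifolds and Kirby Calculus*, §5.2: the surgery depends on the framing only
through its homotopy class). [cite: GompfStipsiczGSM1999, §5.2] -/
def Joined (L L' : OpLoop) : Prop :=
  ∃ F : ℝ → OpLoop,
    ContinuousOn (fun p : ℝ × (𝕊 1) ↦ (F p.1).toFun p.2) (Icc 0 1 ×ˢ univ) ∧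
    ContinuousOn (fun p : ℝ × (𝕊 1) ↦ (F p.1).inv p.2) (Icc 0 1 ×ˢ univ) ∧
    F 0 = L ∧ F 1 = L'

namespace Joined

/-- Every loop is joined to itself (constant family). [folklore] -/
theorem refl (L : OpLoop) : Joined L L :=
  ⟨fun _ ↦ L, (L.contMDiff_toFun.continuous.comp continuous_snd).continuousOn,
    (L.contMDiff_inv.continuous.comp continuous_snd).continuousOn, rfl, rfl⟩

/-- Joinedness is symmetric (reverse the family). [folklore] -/
theorem symm {L L' : OpLoop} (h : Joined L L') : Joined L' L := by
  obtain ⟨F, hF, hFi, h0, h1⟩ := h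
  have hmaps : MapsTo (fun p : ℝ × (𝕊 1) ↦ (1 - p.1, p.2)) (Icc 0 1 ×ˢ univ) (Icc 0 1 ×ˢ univ) :=
    fun p hp ↦ ⟨⟨by linarith [hp.1.2], by linarith [hp.1.1]⟩, mem_univ _⟩
  have hc : Continuous fun p : ℝ × (𝕊 1) ↦ (1 - p.1, p.2) := by fun_prop
  refine ⟨fun t ↦ F (1 - t), hF.comp hc.continuousOn hmaps, hFi.comp hc.continuousOn hmaps, ?_, ?_⟩
  · simp [h1]
  · simp [h0]

/-- **Joinedness is transitive** (concatenate the two families at `t = 1/2`). [folklore] -/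
theorem trans {L L' L'' : OpLoop} (h : Joined L L') (h' : Joined L' L'') : Joined L L'' := by
  obtain ⟨F, hF, hFi, hF0, hF1⟩ := h
  obtain ⟨G, hG, hGi, hG0, hG1⟩ := h'
  classical
  set H : ℝ → OpLoop := fun t ↦ if t ≤ 1 / 2 then F (2 * t) else G (2 * t - 1) with hH
  have hc₁ : Continuous fun p : ℝ × (𝕊 1) ↦ (2 * p.1, p.2) := by fun_prop
  have hc₂ : Continuous fun p : ℝ × (𝕊 1) ↦ (2 * p.1 - 1, p.2) := by fun_prop
  have hm₁ : MapsTo (fun p : ℝ × (𝕊 1) ↦ (2 * p.1, p.2)) (Icc 0 1 ×ˢ univ ∩ closure {p | p.1 ≤ 1 / 2})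
      (Icc 0 1 ×ˢ univ) := by
    intro p hp
    rw [closure_le_eq continuous_fst continuous_const] at hp
    have h1 : (0 : ℝ) ≤ p.1 := hp.1.1.1
    have h2 : p.1 ≤ 1 / 2 := hp.2
    refine ⟨⟨?_, ?_⟩, mem_univ _⟩ <;> dsimp only <;> linarith
  have hm₂ : MapsTo (fun p : ℝ × (𝕊 1) ↦ (2 * p.1 - 1, p.2)) (Icc 0 1 ×ˢ univ ∩ closure {p | ¬ p.1 ≤ 1 / 2})
      (Icc 0 1 ×ˢ univ) := by
    intro p hp
    have h2 : p ∈ closure {q : ℝ × (𝕊 1) | 1 / 2 < q.1} := by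
      have : {q : ℝ × (𝕊 1) | ¬ q.1 ≤ 1 / 2} = {q | 1 / 2 < q.1} := by ext; simp [not_le]
      rw [this] at hp; exact hp.2
    have h3 : (1 : ℝ) / 2 ≤ p.1 := by
      have hsub : closure {q : ℝ × (𝕊 1) | 1 / 2 < q.1} ⊆ {q | 1 / 2 ≤ q.1} :=
        closure_minimal (fun q hq ↦ show (1 : ℝ) / 2 ≤ q.1 from le_of_lt hq)
          (isClosed_le continuous_const continuous_fst)
      exact hsub h2
    have h4 : p.1 ≤ 1 := hp.1.1.2
    refine ⟨⟨?_, ?_⟩, mem_univ _⟩ <;> dsimp only <;> linarith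
  have hfr : ∀ p ∈ Icc (0 : ℝ) 1 ×ˢ (univ : Set (𝕊 1)) ∩ frontier {q : ℝ × (𝕊 1) | q.1 ≤ 1 / 2}, p.1 = 1 / 2 := by
    intro p hp
    have hsub : frontier {q : ℝ × (𝕊 1) | q.1 ≤ 1 / 2} ⊆ {q | q.1 = 1 / 2} :=
      frontier_le_subset_eq continuous_fst continuous_const
    exact hsub hp.2
  refine ⟨H, ?_, ?_, ?_, ?_⟩
  · have key : ContinuousOn (fun p : ℝ × (𝕊 1) ↦ if p.1 ≤ 1 / 2 then (F (2 * p.1)).toFun p.2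
        else (G (2 * p.1 - 1)).toFun p.2) (Icc 0 1 ×ˢ univ) := by
      refine ContinuousOn.if (fun p hp ↦ ?_) (hF.comp hc₁.continuousOn hm₁) (hG.comp hc₂.continuousOn hm₂)
      have hp1 := hfr p hp
      simp only [hp1]
      norm_num [hF1, hG0]
    refine key.congr fun p _ ↦ ?_
    simp only [hH]
    split_ifs <;> rfl
  · have key : ContinuousOn (fun p : ℝ × (𝕊 1) ↦ if p.1 ≤ 1 / 2 then (F (2 * p.1)).inv p.2
        else (G (2 * p.1 - 1)).inv p.2) (Icc 0 1 ×ˢ univ) := by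
      refine ContinuousOn.if (fun p hp ↦ ?_) (hFi.comp hc₁.continuousOn hm₁) (hGi.comp hc₂.continuousOn hm₂)
      have hp1 := hfr p hp
      simp only [hp1]
      norm_num [hF1, hG0]
    refine key.congr fun p _ ↦ ?_
    simp only [hH]
    split_ifs <;> rfl
  · show (if (0 : ℝ) ≤ 1 / 2 then F (2 * 0) else G (2 * 0 - 1)) = L
    rw [if_pos (by norm_num)]
    norm_num [hF0]
  · show (if (1 : ℝ) ≤ 1 / 2 then F (2 * 1) else G (2 * 1 - 1)) = L''
    rw [if_neg (by norm_num)]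
    norm_num [hG1]

/-- **Products of joined loops are joined.** [folklore] -/
theorem mul {L₁ L₁' L₂ L₂' : OpLoop} (h₁ : Joined L₁ L₁') (h₂ : Joined L₂ L₂') :
    Joined (L₁.mul L₂) (L₁'.mul L₂') := by
  obtain ⟨F, hF, hFi, hF0, hF1⟩ := h₁
  obtain ⟨G, hG, hGi, hG0, hG1⟩ := h₂
  refine ⟨fun t ↦ (F t).mul (G t), ?_, ?_, by simp [hF0, hG0], by simp [hF1, hG1]⟩
  · exact hF.mul hG
  · exact hGi.mul hFi

end Joined

/-! ### Loops given by their operators alone -/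

/-- **Two loops with the same operators are equal** (the inverses are determined). [folklore] -/
theorem ext' {L L' : OpLoop} (h : L.toFun = L'.toFun) : L = L' := by
  have hi : L.inv = L'.inv := by
    funext u
    calc L.inv u = L.inv u * (L'.toFun u * L'.inv u) := by rw [L'.mul_inv, _root_.mul_one]
      _ = (L.inv u * L.toFun u) * L'.inv u := by rw [h, mul_assoc]
      _ = L'.inv u := by rw [L.inv_mul, _root_.one_mul]
  cases L; cases L'
  simp only at h hi
  subst h; subst hi
  rfl

/-- **A smooth loop of invertible operators is an `OpLoop`**, the inverses being supplied by
`Ring.inverse` (smooth at the units of the complete normed algebra `𝔼 3 →L 𝔼 3`). [folklore] -/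
def ofUnits (f : 𝕊 1 → (𝔼 3 →L[ℝ] 𝔼 3)) (hf : ContMDiff (𝓡 1) 𝓘(ℝ, 𝔼 3 →L[ℝ] 𝔼 3) ∞ f)
    (hu : ∀ u, IsUnit (f u)) : OpLoop where
  toFun := f
  inv u := Ring.inverse (f u)
  contMDiff_toFun := hf
  contMDiff_inv u := by
    have h1 : ContDiffAt ℝ ∞ Ring.inverse (f u) := by
      have := contDiffAt_ringInverse ℝ (n := ∞) (hu u).unit
      rwa [IsUnit.unit_spec] at this
    exact h1.comp_contMDiffAt (hf u)
  mul_inv u := Ring.mul_inverse_cancel _ (hu u)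
  inv_mul u := Ring.inverse_mul_cancel _ (hu u)

/-- The operators of `ofUnits`. [folklore] -/
@[simp] theorem ofUnits_toFun (f : 𝕊 1 → (𝔼 3 →L[ℝ] 𝔼 3)) (hf : ContMDiff (𝓡 1) 𝓘(ℝ, 𝔼 3 →L[ℝ] 𝔼 3) ∞ f)
    (hu : ∀ u, IsUnit (f u)) : (ofUnits f hf hu).toFun = f := rfl

/-- The operators of a loop are units. [folklore] -/
theorem isUnit_toFun (L : OpLoop) (u : 𝕊 1) : IsUnit (L.toFun u) :=
  ⟨⟨L.toFun u, L.inv u, L.mul_inv u, L.inv_mul u⟩, rfl⟩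

/-- Every loop is `ofUnits` of its operators. [folklore] -/
theorem eq_ofUnits (L : OpLoop) : L = ofUnits L.toFun L.contMDiff_toFun L.isUnit_toFun := ext' rfl

/-- **The two ends of a jointly continuous family of smooth loops of invertible operators are
joined** (the inverses are automatically jointly continuous: `Ring.inverse` is continuous at
units). [cite: GompfStipsiczGSM1999, §5.2] -/
theorem joined_ofUnits {F : ℝ → 𝕊 1 → (𝔼 3 →L[ℝ] 𝔼 3)}
    (hF : ∀ t, ContMDiff (𝓡 1) 𝓘(ℝ, 𝔼 3 →L[ℝ] 𝔼 3) ∞ (F t)) (hu : ∀ t u, IsUnit (F t u))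
    (hc : ContinuousOn (fun p : ℝ × (𝕊 1) ↦ F p.1 p.2) (Icc 0 1 ×ˢ univ)) :
    Joined (ofUnits (F 0) (hF 0) (hu 0)) (ofUnits (F 1) (hF 1) (hu 1)) := by
  refine ⟨fun t ↦ ofUnits (F t) (hF t) (hu t), hc, ?_, rfl, rfl⟩
  intro p hp
  have h1 : ContinuousAt Ring.inverse ((fun q : ℝ × (𝕊 1) ↦ F q.1 q.2) p) := by
    have := NormedRing.inverse_continuousAt (hu p.1 p.2).unit
    rwa [IsUnit.unit_spec] at this
  exact ContinuousAt.comp_continuousWithinAt (g := Ring.inverse) (f := fun q : ℝ × (𝕊 1) ↦ F q.1 q.2) h1 (hc p hp)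

/-- Variant with prescribed ends. [folklore] -/
theorem joined_of_family {L L' : OpLoop} {F : ℝ → 𝕊 1 → (𝔼 3 →L[ℝ] 𝔼 3)}
    (hF : ∀ t, ContMDiff (𝓡 1) 𝓘(ℝ, 𝔼 3 →L[ℝ] 𝔼 3) ∞ (F t)) (hu : ∀ t u, IsUnit (F t u))
    (hc : ContinuousOn (fun p : ℝ × (𝕊 1) ↦ F p.1 p.2) (Icc 0 1 ×ˢ univ))
    (h0 : F 0 = L.toFun) (h1 : F 1 = L'.toFun) : Joined L L' := by
  have h := joined_ofUnits hF hu hc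
  have e0 : ofUnits (F 0) (hF 0) (hu 0) = L := ext' h0
  have e1 : ofUnits (F 1) (hF 1) (hu 1) = L' := ext' h1
  rwa [e0, e1] at h

/-! ### Invertibility from the determinant -/

/-- **An operator of `𝔼 3` with nonzero determinant is a unit.** [folklore] -/
theorem isUnit_of_det_ne_zero {f : 𝔼 3 →L[ℝ] 𝔼 3} (hf : LinearMap.det (f : 𝔼 3 →ₗ[ℝ] 𝔼 3) ≠ 0) :
    IsUnit f := by
  have h1 : IsUnit (toMat f) := by
    rw [Matrix.isUnit_iff_isUnit_det, det_toMat]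
    exact isUnit_iff_ne_zero.2 hf
  have h2 : IsUnit (matCLM (toMat f)) := h1.map (Matrix.toEuclideanCLM (n := Fin 3) (𝕜 := ℝ))
  rwa [matCLM_toMat] at h2

/-! ### The twisted loop: one full turn about the third axis -/

/-- The rotation matrix `rot u = [[u₀, -u₁, 0], [u₁, u₀, 0], [0, 0, 1]]` of the plane `⟨e₀, e₁⟩`
through the angle of `u ∈ 𝕊¹` (linear in `u`). [cite: GompfStipsiczGSM1999, §5.2] -/
def rotMat (u : 𝔼 2) : Matrix (Fin 3) (Fin 3) ℝ :=
  !![u 0, -u 1, 0; u 1, u 0, 0; 0, 0, 1]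

/-- The inverse rotation matrix `[[u₀, u₁, 0], [-u₁, u₀, 0], [0, 0, 1]]`. [folklore] -/
def rotMatInv (u : 𝔼 2) : Matrix (Fin 3) (Fin 3) ℝ :=
  !![u 0, u 1, 0; -u 1, u 0, 0; 0, 0, 1]

/-- `rot u · rot⁻¹ u = 1` on the circle. [folklore] -/
theorem rotMat_mul_rotMatInv (u : 𝔼 2) (hu : u 0 ^ 2 + u 1 ^ 2 = 1) : rotMat u * rotMatInv u = 1 := by
  ext i j
  fin_cases i <;> fin_cases j <;>
    simp [rotMat, rotMatInv, Matrix.mul_apply, Fin.sum_univ_three] <;> nlinarith [hu]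

/-- `rot⁻¹ u · rot u = 1` on the circle. [folklore] -/
theorem rotMatInv_mul_rotMat (u : 𝔼 2) (hu : u 0 ^ 2 + u 1 ^ 2 = 1) : rotMatInv u * rotMat u = 1 := by
  ext i j
  fin_cases i <;> fin_cases j <;>
    simp [rotMat, rotMatInv, Matrix.mul_apply, Fin.sum_univ_three] <;> nlinarith [hu]

/-- On the circle, `u₀² + u₁² = 1`. [folklore] -/
theorem sq_add_sq_of_mem_sphere (u : 𝕊 1) : (u : 𝔼 2) 0 ^ 2 + (u : 𝔼 2) 1 ^ 2 = 1 := by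
  have h := norm_eq_of_mem_sphere u
  have h2 : ‖(u : 𝔼 2)‖ ^ 2 = 1 := by rw [h, one_pow]
  rw [EuclideanSpace.real_norm_sq_eq, Fin.sum_univ_two] at h2
  exact h2

/-- The entries of `rotMat u` are smooth in `u ∈ 𝕊¹`. [folklore] -/
theorem contMDiff_rotMat_entry (i j : Fin 3) : ContMDiff (𝓡 1) 𝓘(ℝ, ℝ) ∞ fun u : 𝕊 1 ↦ rotMat (u : 𝔼 2) i j := by
  haveI := Fact.mk (@finrank_euclideanSpace_fin ℝ _ 2)
  have hc : ContMDiff (𝓡 1) 𝓘(ℝ, 𝔼 2) ∞ fun u : 𝕊 1 ↦ (u : 𝔼 2) := contMDiff_coe_sphere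
  have h0 : ContMDiff (𝓡 1) 𝓘(ℝ, ℝ) ∞ fun u : 𝕊 1 ↦ (u : 𝔼 2) 0 :=
    ((EuclideanSpace.proj (𝕜 := ℝ) (0 : Fin 2)).contDiff.comp_contMDiff hc)
  have h1 : ContMDiff (𝓡 1) 𝓘(ℝ, ℝ) ∞ fun u : 𝕊 1 ↦ (u : 𝔼 2) 1 :=
    ((EuclideanSpace.proj (𝕜 := ℝ) (1 : Fin 2)).contDiff.comp_contMDiff hc)
  fin_cases i <;> fin_cases j <;> simp [rotMat] <;> first | exact h0 | exact h1 | exact h1.neg | exact contMDiff_const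

/-- The entries of `rotMatInv u` are smooth in `u ∈ 𝕊¹`. [folklore] -/
theorem contMDiff_rotMatInv_entry (i j : Fin 3) :
    ContMDiff (𝓡 1) 𝓘(ℝ, ℝ) ∞ fun u : 𝕊 1 ↦ rotMatInv (u : 𝔼 2) i j := by
  haveI := Fact.mk (@finrank_euclideanSpace_fin ℝ _ 2)
  have hc : ContMDiff (𝓡 1) 𝓘(ℝ, 𝔼 2) ∞ fun u : 𝕊 1 ↦ (u : 𝔼 2) := contMDiff_coe_sphere
  have h0 : ContMDiff (𝓡 1) 𝓘(ℝ, ℝ) ∞ fun u : 𝕊 1 ↦ (u : 𝔼 2) 0 :=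
    ((EuclideanSpace.proj (𝕜 := ℝ) (0 : Fin 2)).contDiff.comp_contMDiff hc)
  have h1 : ContMDiff (𝓡 1) 𝓘(ℝ, ℝ) ∞ fun u : 𝕊 1 ↦ (u : 𝔼 2) 1 :=
    ((EuclideanSpace.proj (𝕜 := ℝ) (1 : Fin 2)).contDiff.comp_contMDiff hc)
  fin_cases i <;> fin_cases j <;> simp [rotMatInv] <;> first | exact h0 | exact h1 | exact h1.neg | exact contMDiff_const

/-- **A matrix-valued map on the circle with smooth entries is smooth as an operator-valued map.** [folklore] -/
theorem contMDiff_matCLM_of_entries {m : 𝕊 1 → Matrix (Fin 3) (Fin 3) ℝ}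
    (hm : ∀ i j, ContMDiff (𝓡 1) 𝓘(ℝ, ℝ) ∞ fun u ↦ m u i j) :
    ContMDiff (𝓡 1) 𝓘(ℝ, 𝔼 3 →L[ℝ] 𝔼 3) ∞ fun u ↦ matCLM (m u) := by
  have h : ∀ u, matCLM (m u) = ∑ i, ∑ j, m u i j • matCLM (Matrix.single i j 1) := fun u ↦ matCLM_eq_sum (m u)
  simp_rw [h]
  exact ContMDiff.sum fun i _ ↦ ContMDiff.sum fun j _ ↦ (hm i j).smul contMDiff_const

/-- **The twisted loop**: one full turn of the plane `⟨e₀, e₁⟩` about `e₂` as `u` runs once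
around the circle — the generator of `π₁ SO(3) = ℤ/2`, i.e. the other framing of a circle in a
`4`-manifold (Gompf–Stipsicz §5.2). [cite: GompfStipsiczGSM1999, §5.2] -/
def twist : OpLoop where
  toFun u := matCLM (rotMat (u : 𝔼 2))
  inv u := matCLM (rotMatInv (u : 𝔼 2))
  contMDiff_toFun := contMDiff_matCLM_of_entries contMDiff_rotMat_entry
  contMDiff_inv := contMDiff_matCLM_of_entries contMDiff_rotMatInv_entry
  mul_inv u := by rw [← matCLM_mul, rotMat_mul_rotMatInv _ (sq_add_sq_of_mem_sphere u), matCLM_one]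
  inv_mul u := by rw [← matCLM_mul, rotMatInv_mul_rotMat _ (sq_add_sq_of_mem_sphere u), matCLM_one]


/-! ### The doubled twist is null: `π₁ SO(3)` has order two (quaternions) -/

/-- **The quaternion rotation matrix** of `q = a + bi + cj + dk` acting on the imaginary
quaternions by `v ↦ q v q̄` (times `|q|²`; no normalisation, so that the entries are polynomial). [folklore] -/
def quatMat (a b c d : ℝ) : Matrix (Fin 3) (Fin 3) ℝ :=
  !![a ^ 2 + b ^ 2 - c ^ 2 - d ^ 2, 2 * (b * c - a * d), 2 * (b * d + a * c);
     2 * (b * c + a * d), a ^ 2 - b ^ 2 + c ^ 2 - d ^ 2, 2 * (c * d - a * b);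
     2 * (b * d - a * c), 2 * (c * d + a * b), a ^ 2 - b ^ 2 - c ^ 2 + d ^ 2]

/-- **`M(q) M(q̄) = |q|⁴`**: the quaternion matrices are invertible for `q ≠ 0`. [folklore] -/
theorem quatMat_mul_conj (a b c d : ℝ) :
    quatMat a b c d * quatMat a (-b) (-c) (-d) = ((a ^ 2 + b ^ 2 + c ^ 2 + d ^ 2) ^ 2) • (1 : Matrix (Fin 3) (Fin 3) ℝ) := by
  ext i j
  fin_cases i <;> fin_cases j <;>
    simp [quatMat, Matrix.mul_apply, Fin.sum_univ_three] <;> ring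

/-- `M(q̄) M(q) = |q|⁴`. [folklore] -/
theorem quatMat_conj_mul (a b c d : ℝ) :
    quatMat a (-b) (-c) (-d) * quatMat a b c d = ((a ^ 2 + b ^ 2 + c ^ 2 + d ^ 2) ^ 2) • (1 : Matrix (Fin 3) (Fin 3) ℝ) := by
  have h := quatMat_mul_conj a (-b) (-c) (-d)
  simp only [neg_neg, even_two, Even.neg_pow] at h
  exact h

/-- **The unit complex numbers `u₀ + u₁ k` give the doubled twist**: `M(u₀, 0, 0, u₁) = rot(u)²`
on the circle. [folklore] -/
theorem quatMat_circle (u : 𝔼 2) (hu : u 0 ^ 2 + u 1 ^ 2 = 1) :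
    quatMat (u 0) 0 0 (u 1) = rotMat u * rotMat u := by
  ext i j
  fin_cases i <;> fin_cases j <;>
    simp [quatMat, rotMat, Matrix.mul_apply, Fin.sum_univ_three] <;> nlinarith [hu]

/-- `M(j) = diag(-1, 1, -1)`, the half turn about the second axis. [folklore] -/
theorem quatMat_j : quatMat 0 0 1 0 = !![-1, 0, 0; 0, 1, 0; 0, 0, -1] := by
  ext i j
  fin_cases i <;> fin_cases j <;> simp [quatMat]

/-- A matrix with a two-sided inverse up to a nonzero scalar gives a unit operator. [folklore] -/
theorem isUnit_matCLM_of_mul_eq_smul_one {A B : Matrix (Fin 3) (Fin 3) ℝ} {c : ℝ} (hc : c ≠ 0)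
    (h₁ : A * B = c • (1 : Matrix (Fin 3) (Fin 3) ℝ)) (h₂ : B * A = c • (1 : Matrix (Fin 3) (Fin 3) ℝ)) :
    IsUnit (matCLM A) := by
  have hA : IsUnit A := by
    refine ⟨⟨A, c⁻¹ • B, ?_, ?_⟩, rfl⟩
    · rw [Matrix.mul_smul, h₁, smul_smul, inv_mul_cancel₀ hc, one_smul]
    · rw [Matrix.smul_mul, h₂, smul_smul, inv_mul_cancel₀ hc, one_smul]
  exact hA.map (Matrix.toEuclideanCLM (n := Fin 3) (𝕜 := ℝ))

/-- **The quaternion family** `t ↦ M((1 - t)(u₀ + u₁ k) + t j)`: entries polynomial in `t` and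
`u`, never singular (`|q_t|² = (1-t)² + t² > 0` on the circle); from the doubled twist (`t = 0`)
to the constant half turn `M(j)` (`t = 1`). [folklore] -/
def quatFamily (t : ℝ) (u : 𝕊 1) : 𝔼 3 →L[ℝ] 𝔼 3 :=
  matCLM (quatMat ((1 - t) * (u : 𝔼 2) 0) 0 t ((1 - t) * (u : 𝔼 2) 1))

/-- The coordinates of a point of the circle are smooth. [folklore] -/
theorem contMDiff_coord (i : Fin 2) : ContMDiff (𝓡 1) 𝓘(ℝ, ℝ) ∞ fun u : 𝕊 1 ↦ (u : 𝔼 2) i :=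
  haveI := Fact.mk (@finrank_euclideanSpace_fin ℝ _ 2)
  (EuclideanSpace.proj (𝕜 := ℝ) i).contDiff.comp_contMDiff contMDiff_coe_sphere

/-- The coordinates of a point of the circle are continuous. [folklore] -/
theorem continuous_coord (i : Fin 2) : Continuous fun u : 𝕊 1 ↦ (u : 𝔼 2) i :=
  (contMDiff_coord i).continuous

/-- The entries of `quatMat a 0 t d` are smooth in `(a, d)`. [folklore] -/
theorem contDiff_quatMat_entry (t : ℝ) (i j : Fin 3) : ContDiff ℝ ∞ fun p : ℝ × ℝ ↦ quatMat p.1 0 t p.2 i j := by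
  fin_cases i <;> fin_cases j <;> simp [quatMat] <;> fun_prop

/-- The entries of the quaternion family are smooth in `u`. [folklore] -/
theorem contMDiff_quatFamily (t : ℝ) : ContMDiff (𝓡 1) 𝓘(ℝ, 𝔼 3 →L[ℝ] 𝔼 3) ∞ (quatFamily t) := by
  refine contMDiff_matCLM_of_entries fun i j ↦ ?_
  have ha : ContMDiff (𝓡 1) 𝓘(ℝ, ℝ) ∞ fun u : 𝕊 1 ↦ (1 - t) * (u : 𝔼 2) 0 := contMDiff_const.mul (contMDiff_coord 0)
  have hd : ContMDiff (𝓡 1) 𝓘(ℝ, ℝ) ∞ fun u : 𝕊 1 ↦ (1 - t) * (u : 𝔼 2) 1 := contMDiff_const.mul (contMDiff_coord 1)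
  have heq : (fun u : 𝕊 1 ↦ quatMat ((1 - t) * (u : 𝔼 2) 0) 0 t ((1 - t) * (u : 𝔼 2) 1) i j) =
      (fun p : ℝ × ℝ ↦ quatMat p.1 0 t p.2 i j) ∘ fun u : 𝕊 1 ↦ ((1 - t) * (u : 𝔼 2) 0, (1 - t) * (u : 𝔼 2) 1) := rfl
  rw [heq]
  exact (contDiff_quatMat_entry t i j).comp_contMDiff (ha.prodMk_space hd)

/-- The quaternion family is jointly continuous. [folklore] -/
theorem continuous_quatFamily : Continuous fun p : ℝ × (𝕊 1) ↦ quatFamily p.1 p.2 := by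
  unfold quatFamily
  refine continuous_matCLM.comp ?_
  refine continuous_matrix fun i j ↦ ?_
  have h0 : Continuous fun p : ℝ × (𝕊 1) ↦ ((p.2 : 𝕊 1) : 𝔼 2) 0 := (continuous_coord 0).comp continuous_snd
  have h1 : Continuous fun p : ℝ × (𝕊 1) ↦ ((p.2 : 𝕊 1) : 𝔼 2) 1 := (continuous_coord 1).comp continuous_snd
  have ht : Continuous fun p : ℝ × (𝕊 1) ↦ p.1 := continuous_fst
  fin_cases i <;> fin_cases j <;> simp [quatMat] <;> fun_prop

/-- The quaternion family consists of units. [folklore] -/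
theorem isUnit_quatFamily (t : ℝ) (u : 𝕊 1) : IsUnit (quatFamily t u) := by
  have hu := sq_add_sq_of_mem_sphere u
  set a := (1 - t) * (u : 𝔼 2) 0
  set d := (1 - t) * (u : 𝔼 2) 1
  have hq : (a ^ 2 + (0 : ℝ) ^ 2 + t ^ 2 + d ^ 2) ^ 2 ≠ 0 := by
    have : a ^ 2 + d ^ 2 = (1 - t) ^ 2 := by
      simp only [a, d]; nlinarith [hu]
    have hpos : 0 < a ^ 2 + 0 ^ 2 + t ^ 2 + d ^ 2 := by nlinarith [sq_nonneg (1 - 2 * t)]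
    positivity
  have h₁ := quatMat_mul_conj a 0 t d
  have h₂ := quatMat_conj_mul a 0 t d
  simp only [neg_zero] at h₁ h₂
  exact isUnit_matCLM_of_mul_eq_smul_one hq h₁ h₂

/-- The half turn `diag(-1, 1, -1)` about the second axis. [folklore] -/
def halfTurnMat : Matrix (Fin 3) (Fin 3) ℝ := !![-1, 0, 0; 0, 1, 0; 0, 0, -1]

/-- The half turn is an involution. [folklore] -/
theorem halfTurnMat_mul_self : halfTurnMat * halfTurnMat = 1 := by
  ext i j
  fin_cases i <;> fin_cases j <;> simp [halfTurnMat, Matrix.mul_apply, Fin.sum_univ_three]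

/-- **The constant loop at the half turn.** [folklore] -/
def halfTurn : OpLoop where
  toFun _ := matCLM halfTurnMat
  inv _ := matCLM halfTurnMat
  contMDiff_toFun := contMDiff_const
  contMDiff_inv := contMDiff_const
  mul_inv _ := by rw [← matCLM_mul, halfTurnMat_mul_self, matCLM_one]
  inv_mul _ := by rw [← matCLM_mul, halfTurnMat_mul_self, matCLM_one]

/-- **The doubled twist is joined to the constant half turn** (the quaternion family). [folklore] -/
theorem joined_twist_mul_twist_halfTurn : Joined (twist.mul twist) halfTurn := by
  refine joined_of_family contMDiff_quatFamily isUnit_quatFamily continuous_quatFamily.continuousOn ?_ ?_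
  · funext u
    show matCLM (quatMat ((1 - 0) * (u : 𝔼 2) 0) 0 0 ((1 - 0) * (u : 𝔼 2) 1)) =
      matCLM (rotMat (u : 𝔼 2)) * matCLM (rotMat (u : 𝔼 2))
    rw [sub_zero, _root_.one_mul, _root_.one_mul, ← matCLM_mul, quatMat_circle _ (sq_add_sq_of_mem_sphere u)]
  · funext u
    show matCLM (quatMat ((1 - 1) * (u : 𝔼 2) 0) 0 1 ((1 - 1) * (u : 𝔼 2) 1)) = matCLM halfTurnMat
    rw [sub_self, zero_mul, zero_mul, quatMat_j]
    rfl

/-- The rotation about the second axis through the angle `s`. [folklore] -/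
def rotYMat (s : ℝ) : Matrix (Fin 3) (Fin 3) ℝ :=
  !![Real.cos s, 0, Real.sin s; 0, 1, 0; -Real.sin s, 0, Real.cos s]

/-- `R_y(s) R_y(-s) = 1`. [folklore] -/
theorem rotYMat_mul_neg (s : ℝ) : rotYMat s * rotYMat (-s) = 1 := by
  ext i j
  fin_cases i <;> fin_cases j <;>
    simp [rotYMat, Matrix.mul_apply, Fin.sum_univ_three, Real.cos_neg, Real.sin_neg] <;>
    nlinarith [Real.sin_sq_add_cos_sq s]

/-- `R_y(-s) R_y(s) = 1`. [folklore] -/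
theorem rotYMat_neg_mul (s : ℝ) : rotYMat (-s) * rotYMat s = 1 := by
  have h := rotYMat_mul_neg (-s)
  rwa [neg_neg] at h

/-- `R_y(π)` is the half turn. [folklore] -/
theorem rotYMat_pi : rotYMat Real.pi = halfTurnMat := by
  ext i j
  fin_cases i <;> fin_cases j <;> simp [rotYMat, halfTurnMat]

/-- `R_y(0) = 1`. [folklore] -/
theorem rotYMat_zero : rotYMat 0 = 1 := by
  ext i j
  fin_cases i <;> fin_cases j <;> simp [rotYMat]

/-- **The constant half turn is joined to the identity loop** (rotate back about the second
axis: the constant-in-`u` family `R_y(π(1 - t))`). [folklore] -/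
theorem joined_halfTurn_one : Joined halfTurn one := by
  refine joined_of_family (F := fun t _ ↦ matCLM (rotYMat (Real.pi * (1 - t)))) (fun t ↦ contMDiff_const)
    (fun t u ↦ ?_) ?_ ?_ ?_
  · exact isUnit_matCLM_of_mul_eq_smul_one one_ne_zero (by rw [one_smul]; exact rotYMat_mul_neg _)
      (by rw [one_smul]; exact rotYMat_neg_mul _)
  · refine (continuous_matCLM.comp ?_).continuousOn
    refine continuous_matrix fun i j ↦ ?_
    have ht : Continuous fun p : ℝ × (𝕊 1) ↦ Real.pi * (1 - p.1) := by fun_prop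
    fin_cases i <;> fin_cases j <;> simp [rotYMat] <;> fun_prop
  · funext u
    show matCLM (rotYMat (Real.pi * (1 - 0))) = matCLM halfTurnMat
    rw [sub_zero, _root_.mul_one, rotYMat_pi]
  · funext u
    show matCLM (rotYMat (Real.pi * (1 - 1))) = (1 : 𝔼 3 →L[ℝ] 𝔼 3)
    rw [sub_self, mul_zero, rotYMat_zero, matCLM_one]

/-- **`twist² ∼ 1`: the doubled twist is joined to the identity loop** (`π₁ SO(3) = ℤ/2`: the loop
of unit quaternions `u₀ + u₁ k` double-covers the doubled rotation loop and is null in `S³`). [cite: GompfStipsiczGSM1999, §5.2] -/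
theorem joined_twist_mul_twist_one : Joined (twist.mul twist) one :=
  joined_twist_mul_twist_halfTurn.trans joined_halfTurn_one

/-! ### Rotations of the first coordinate plane given by unit complex numbers -/

/-- The rotation of the plane `⟨e₀, e₁⟩` by the complex number `w` (a homothety-rotation; a
rotation for `‖w‖ = 1`). [folklore] -/
def rotC (w : ℂ) : Matrix (Fin 3) (Fin 3) ℝ := !![w.re, -w.im, 0; w.im, w.re, 0; 0, 0, 1]

/-- `rotC` is multiplicative. [folklore] -/
theorem rotC_mul (w w' : ℂ) : rotC (w * w') = rotC w * rotC w' := by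
  ext i j
  fin_cases i <;> fin_cases j <;>
    simp [rotC, Matrix.mul_apply, Fin.sum_univ_three, Complex.mul_re, Complex.mul_im] <;> ring

/-- `rotC 1 = 1`. [folklore] -/
@[simp] theorem rotC_one : rotC 1 = 1 := by
  ext i j
  fin_cases i <;> fin_cases j <;> simp [rotC]

/-- For a unit complex number, `rotC w · rotC w̄ = 1`. [folklore] -/
theorem rotC_mul_conj {w : ℂ} (hw : ‖w‖ = 1) : rotC w * rotC (starRingEnd ℂ w) = 1 := by
  rw [← rotC_mul, Complex.mul_conj, Complex.normSq_eq_norm_sq, hw, one_pow, Complex.ofReal_one, rotC_one]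

/-- For a unit complex number, `rotC w̄ · rotC w = 1`. [folklore] -/
theorem rotC_conj_mul {w : ℂ} (hw : ‖w‖ = 1) : rotC (starRingEnd ℂ w) * rotC w = 1 := by
  rw [← rotC_mul, mul_comm, Complex.mul_conj, Complex.normSq_eq_norm_sq, hw, one_pow, Complex.ofReal_one, rotC_one]

/-- `rotMat u = rotC (toC u)`. [folklore] -/
theorem rotMat_eq_rotC (u : 𝔼 2) : rotMat u = rotC (toC u) := by
  ext i j
  fin_cases i <;> fin_cases j <;> rfl

/-- `rotC` is smooth (linear in `re w`, `im w`). [folklore] -/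
theorem contDiff_rotC_entry (i j : Fin 3) : ContDiff ℝ ∞ fun w : ℂ ↦ rotC w i j := by
  have hre : ContDiff ℝ ∞ fun w : ℂ ↦ w.re := Complex.reCLM.contDiff
  have him : ContDiff ℝ ∞ fun w : ℂ ↦ w.im := Complex.imCLM.contDiff
  fin_cases i <;> fin_cases j <;> simp [rotC] <;> first | exact hre | exact him | exact him.neg | exact contDiff_const

/-- `rotC` is continuous. [folklore] -/
theorem continuous_rotC : Continuous rotC :=
  continuous_matrix fun i j ↦ (contDiff_rotC_entry i j).continuous

/-- **The rotation loop of a smooth unit-complex-valued function on the circle.** [folklore] -/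
def rotLoop (g : 𝕊 1 → ℂ) (hg : ContMDiff (𝓡 1) 𝓘(ℝ, ℂ) ∞ g) (h1 : ∀ u, ‖g u‖ = 1) : OpLoop where
  toFun u := matCLM (rotC (g u))
  inv u := matCLM (rotC (starRingEnd ℂ (g u)))
  contMDiff_toFun := contMDiff_matCLM_of_entries fun i j ↦ (contDiff_rotC_entry i j).comp_contMDiff hg
  contMDiff_inv := contMDiff_matCLM_of_entries fun i j ↦
    (contDiff_rotC_entry i j).comp_contMDiff (Complex.conjCLE.contDiff.comp_contMDiff hg)
  mul_inv u := by rw [← matCLM_mul, rotC_mul_conj (h1 u), matCLM_one]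
  inv_mul u := by rw [← matCLM_mul, rotC_conj_mul (h1 u), matCLM_one]

/-- The operators of a rotation loop. [folklore] -/
@[simp] theorem rotLoop_toFun (g : 𝕊 1 → ℂ) (hg : ContMDiff (𝓡 1) 𝓘(ℝ, ℂ) ∞ g) (h1 : ∀ u, ‖g u‖ = 1) (u : 𝕊 1) :
    (rotLoop g hg h1).toFun u = matCLM (rotC (g u)) := rfl

/-- **The rotation loop of a product is the product of the rotation loops.** [folklore] -/
theorem rotLoop_mul (g g' : 𝕊 1 → ℂ) (hg : ContMDiff (𝓡 1) 𝓘(ℝ, ℂ) ∞ g) (hg' : ContMDiff (𝓡 1) 𝓘(ℝ, ℂ) ∞ g')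
    (h1 : ∀ u, ‖g u‖ = 1) (h1' : ∀ u, ‖g' u‖ = 1) :
    rotLoop (fun u ↦ g u * g' u) ((contDiff_mul (𝔸 := ℂ) (n := ∞)).comp_contMDiff (hg.prodMk_space hg'))
        (fun u ↦ by rw [norm_mul, h1, h1', _root_.mul_one]) =
      (rotLoop g hg h1).mul (rotLoop g' hg' h1') :=
  ext' (funext fun u ↦ by simp only [rotLoop_toFun, mul_toFun, rotC_mul, matCLM_mul])

/-- The unit complex number of a point of the circle has norm one. [folklore] -/
theorem norm_toC_coe (u : 𝕊 1) : ‖toC (u : 𝔼 2)‖ = 1 := norm_toC_sphere u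

/-- **The twist is the rotation loop of `u ↦ u` (as a unit complex number).** [folklore] -/
theorem twist_eq_rotLoop : twist = rotLoop (fun u ↦ toC (u : 𝔼 2)) contMDiff_toC norm_toC_coe :=
  ext' (funext fun u ↦ by simp only [rotLoop_toFun]; rw [← rotMat_eq_rotC]; rfl)

/-- **The identity loop is the rotation loop of the constant `1`.** [folklore] -/
theorem one_eq_rotLoop : one = rotLoop (fun _ ↦ 1) contMDiff_const (fun _ ↦ by simp) :=
  ext' (funext fun u ↦ by simp only [rotLoop_toFun, rotC_one, matCLM_one]; rfl)

/-- Powers of the unit complex number of a point of the circle are smooth. [folklore] -/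
theorem contMDiff_toC_zpow (d : ℤ) : ContMDiff (𝓡 1) 𝓘(ℝ, ℂ) ∞ fun u : 𝕊 1 ↦ toC (u : 𝔼 2) ^ d := by
  cases d with
  | ofNat n =>
    simp only [Int.ofNat_eq_natCast, zpow_natCast]
    exact ((contDiff_id (𝕜 := ℝ) (E := ℂ)).pow n).comp_contMDiff contMDiff_toC
  | negSucc n =>
    simp only [zpow_negSucc]
    intro u
    have hne : toC (u : 𝔼 2) ^ (n + 1) ≠ 0 := pow_ne_zero _ (toC_sphere_ne_zero u)
    have hf : ContMDiff (𝓡 1) 𝓘(ℝ, ℂ) ∞ fun u : 𝕊 1 ↦ toC (u : 𝔼 2) ^ (n + 1) :=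
      ((contDiff_id (𝕜 := ℝ) (E := ℂ)).pow (n + 1)).comp_contMDiff contMDiff_toC
    exact ContDiffAt.comp_contMDiffAt (g := Inv.inv) (f := fun u : 𝕊 1 ↦ toC (u : 𝔼 2) ^ (n + 1))
      (contDiffAt_inv (𝕜 := ℝ) hne) (hf u)

/-- Powers of a unit complex number are unit. [folklore] -/
theorem norm_toC_zpow (d : ℤ) (u : 𝕊 1) : ‖toC (u : 𝔼 2) ^ d‖ = 1 := by
  rw [norm_zpow, norm_toC_coe, one_zpow]

/-- **The `d`-fold twist** `u ↦ rotC (u^d)`. [cite: GompfStipsiczGSM1999, §5.2] -/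
def twistPow (d : ℤ) : OpLoop := rotLoop (fun u ↦ toC (u : 𝔼 2) ^ d) (contMDiff_toC_zpow d) (norm_toC_zpow d)

/-- `twistPow 0 = one`. [folklore] -/
theorem twistPow_zero : twistPow 0 = one :=
  ext' (funext fun u ↦ by simp only [twistPow, rotLoop_toFun, zpow_zero, rotC_one, matCLM_one]; rfl)

/-- `twistPow 1 = twist`. [folklore] -/
theorem twistPow_one : twistPow 1 = twist := by
  rw [twist_eq_rotLoop]
  exact ext' (funext fun u ↦ by simp only [twistPow, rotLoop_toFun, zpow_one])

/-- `twistPow (d + 1) = twistPow d * twist`. [folklore] -/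
theorem twistPow_add_one (d : ℤ) : twistPow (d + 1) = (twistPow d).mul twist := by
  rw [twist_eq_rotLoop]
  refine ext' (funext fun u ↦ ?_)
  simp only [twistPow, rotLoop_toFun, mul_toFun, ← matCLM_mul, ← rotC_mul,
    zpow_add_one₀ (toC_sphere_ne_zero u)]

/-- `twistPow (d - 1) * twist = twistPow d`. [folklore] -/
theorem twistPow_sub_one_mul (d : ℤ) : (twistPow (d - 1)).mul twist = twistPow d := by
  rw [← twistPow_add_one, sub_add_cancel]

/-- `twist⁻¹ ∼ twist` (since `twist² ∼ 1`). [folklore] -/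
theorem joined_twistPow_neg_one_twist : Joined (twistPow (-1)) twist := by
  -- `twistPow (-1) = twistPow (-1) * one ∼ twistPow (-1) * (twist * twist) = (twistPow (-1) * twist) * twist = twist`
  have h1 : Joined ((twistPow (-1)).mul one) ((twistPow (-1)).mul (twist.mul twist)) :=
    (Joined.refl _).mul joined_twist_mul_twist_one.symm
  have h2 : (twistPow (-1)).mul (twist.mul twist) = twist := by
    have hassoc : (twistPow (-1)).mul (twist.mul twist) = ((twistPow (-1)).mul twist).mul twist :=
      ext' (funext fun u ↦ by simp only [mul_toFun, mul_assoc])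
    have h0 : (twistPow (-1)).mul twist = twistPow 0 := by
      have h := twistPow_sub_one_mul 0; rwa [zero_sub] at h
    rw [hassoc, h0, twistPow_zero, one_mul]
  rw [mul_one, h2] at h1
  exact h1

/-- **Every power of the twist is joined to `1` or to the twist** (by the parity of the
exponent). [cite: GompfStipsiczGSM1999, §5.2] -/
theorem joined_twistPow (d : ℤ) : Joined (twistPow d) one ∨ Joined (twistPow d) twist := by
  induction d using Int.induction_on with
  | zero => exact Or.inl (twistPow_zero ▸ Joined.refl _)
  | succ d ih =>
    rw [twistPow_add_one]
    rcases ih with h | h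
    · exact Or.inr (by simpa [one_mul] using h.mul (Joined.refl twist))
    · exact Or.inl ((h.mul (Joined.refl twist)).trans joined_twist_mul_twist_one)
  | pred d ih =>
    -- `twistPow (-d - 1) * twist = twistPow (-d)`
    have hrel : (twistPow (-(d : ℤ) - 1)).mul twist = twistPow (-(d : ℤ)) := twistPow_sub_one_mul _
    -- multiply the induction hypothesis by `twist⁻¹ ∼ twist`… via: X = X * 1 ∼ X * twist² = (X * twist) * twist
    have hX : Joined (twistPow (-(d : ℤ) - 1)) (((twistPow (-(d : ℤ) - 1)).mul twist).mul twist) := by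
      have h1 : Joined ((twistPow (-(d : ℤ) - 1)).mul one) ((twistPow (-(d : ℤ) - 1)).mul (twist.mul twist)) :=
        (Joined.refl _).mul joined_twist_mul_twist_one.symm
      have hassoc : (twistPow (-(d : ℤ) - 1)).mul (twist.mul twist) =
          ((twistPow (-(d : ℤ) - 1)).mul twist).mul twist :=
        ext' (funext fun u ↦ by simp only [mul_toFun, mul_assoc])
      rwa [mul_one, hassoc] at h1
    rw [hrel] at hX
    rcases ih with h | h
    · exact Or.inr (hX.trans (by simpa [one_mul] using h.mul (Joined.refl twist)))
    · exact Or.inl (hX.trans ((h.mul (Joined.refl twist)).trans joined_twist_mul_twist_one))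


/-! ### Descending `2π`-periodic maps and families to the circle -/

/-- **A `2π`-periodic map on the line, read on the circle** (through a chosen angle of each
point; independent of the choice for periodic maps). [folklore] -/
def descend {X : Type*} (P : ℝ → X) (u : 𝕊 1) : X := P (Classical.choose (circlePoint_surjective u))

/-- `descend P (circlePoint φ) = P φ` for periodic `P`. [folklore] -/
theorem descend_circlePoint {X : Type*} {P : ℝ → X} (hP : Periodic P (2 * Real.pi)) (φ : ℝ) :
    descend P (circlePoint φ) = P φ :=
  Periodic.eq_of_circlePoint_eq hP (Classical.choose_spec (circlePoint_surjective (circlePoint φ)))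

/-- `descend P ∘ circlePoint = P` for periodic `P`. [folklore] -/
theorem descend_comp_circlePoint {X : Type*} {P : ℝ → X} (hP : Periodic P (2 * Real.pi)) :
    descend P ∘ circlePoint = P := funext (descend_circlePoint hP)

/-- **A smooth periodic map descends to a smooth map on the circle.** [folklore] -/
theorem contMDiff_descend {V : Type*} [NormedAddCommGroup V] [NormedSpace ℝ V] {P : ℝ → V}
    (hP : Periodic P (2 * Real.pi)) (hs : ContDiff ℝ ∞ P) : ContMDiff (𝓡 1) 𝓘(ℝ, V) ∞ (descend P) := by
  intro u
  obtain ⟨φ, rfl⟩ := circlePoint_surjective u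
  apply contMDiffAt_of_comp_circlePoint
  rw [descend_comp_circlePoint hP]
  exact hs.contMDiff.contMDiffAt

/-- `(t, φ) ↦ (t, circlePoint φ)` is an open quotient map. [folklore] -/
theorem isOpenQuotientMap_prodMap_circlePoint : IsOpenQuotientMap (Prod.map (id : ℝ → ℝ) circlePoint) :=
  ⟨surjective_id.prodMap circlePoint_surjective, continuous_id.prodMap continuous_circlePoint,
    IsOpenMap.id.prodMap isOpenMap_circlePoint⟩

/-- **A jointly continuous family of periodic maps descends to a jointly continuous family on
the circle.** [folklore] -/
theorem continuous_descend_family {X : Type*} [TopologicalSpace X] {P : ℝ → ℝ → X}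
    (hP : ∀ t, Periodic (P t) (2 * Real.pi)) (hc : Continuous fun p : ℝ × ℝ ↦ P p.1 p.2) :
    Continuous fun p : ℝ × (𝕊 1) ↦ descend (P p.1) p.2 := by
  rw [← isOpenQuotientMap_prodMap_circlePoint.continuous_comp_iff]
  have : (fun p : ℝ × (𝕊 1) ↦ descend (P p.1) p.2) ∘ Prod.map id circlePoint = fun p ↦ P p.1 p.2 :=
    funext fun p ↦ descend_circlePoint (hP p.1) p.2
  rw [this]
  exact hc

/-! ### Rotation loops are joined to powers of the twist (the degree) -/

/-- `rotC` of a unit complex number gives a unit operator. [folklore] -/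
theorem isUnit_matCLM_rotC {w : ℂ} (hw : ‖w‖ = 1) : IsUnit (matCLM (rotC w)) :=
  isUnit_matCLM_of_mul_eq_smul_one one_ne_zero (by rw [one_smul]; exact rotC_mul_conj hw)
    (by rw [one_smul]; exact rotC_conj_mul hw)

/-- `exp (x i)` has norm one for real `x`. [folklore] -/
theorem norm_exp_ofReal_mul_I (x : ℝ) : ‖Complex.exp (x * Complex.I)‖ = 1 := by
  rw [Complex.norm_exp_ofReal_mul_I]

/-- **The constant phase loop is joined to the identity** (turn the phase back to `1`). [folklore] -/
theorem joined_phase_one (a : ℝ) :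
    Joined (rotLoop (fun _ ↦ Complex.exp (a * Complex.I)) contMDiff_const (fun _ ↦ norm_exp_ofReal_mul_I a)) one := by
  refine joined_of_family (F := fun t _ ↦ matCLM (rotC (Complex.exp (((1 - t) * a : ℝ) * Complex.I))))
    (fun t ↦ contMDiff_const) (fun t u ↦ isUnit_matCLM_rotC (norm_exp_ofReal_mul_I _)) ?_ ?_ ?_
  · refine (continuous_matCLM.comp (continuous_rotC.comp ?_)).continuousOn
    exact Complex.continuous_exp.comp (by fun_prop)
  · funext u; simp
  · funext u
    show matCLM (rotC (Complex.exp (((1 - 1) * a : ℝ) * Complex.I))) = (1 : 𝔼 3 →L[ℝ] 𝔼 3)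
    rw [sub_self, zero_mul, Complex.ofReal_zero, zero_mul, Complex.exp_zero, rotC_one, matCLM_one]

/-- **A rotation loop is joined to the `d`-fold twist, `d` its degree** (lift the angle,
`CircleAngleLift.lean`, and interpolate the lifted angle linearly to `d φ + α₀`; the
interpolation descends to the circle at every stage since all stages have the same period
defect `2πd`). [cite: GompfStipsiczGSM1999, §5.2] -/
theorem exists_joined_rotLoop_twistPow (f : 𝕊 1 → ℂ) (hf : ContMDiff (𝓡 1) 𝓘(ℝ, ℂ) ∞ f) (h1 : ∀ u, ‖f u‖ = 1) :
    ∃ d : ℤ, Joined (rotLoop f hf h1) (twistPow d) := by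
  -- the lifted angle
  set c : ℝ → ℝ := fun φ ↦ (f (circlePoint φ)).re with hc
  set s : ℝ → ℝ := fun φ ↦ (f (circlePoint φ)).im with hs
  have hF : ContDiff ℝ ∞ fun φ ↦ f (circlePoint φ) := contMDiff_iff_contDiff.1 (hf.comp contMDiff_circlePoint)
  have hcs : ContDiff ℝ ∞ c := Complex.reCLM.contDiff.comp hF
  have hss : ContDiff ℝ ∞ s := Complex.imCLM.contDiff.comp hF
  have hcs1 : ∀ φ, c φ ^ 2 + s φ ^ 2 = 1 := fun φ ↦ by
    have h := h1 (circlePoint φ)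
    have h2 : Complex.normSq (f (circlePoint φ)) = 1 := by
      rw [Complex.normSq_eq_norm_sq, h, one_pow]
    rw [Complex.normSq_apply] at h2
    simp only [hc, hs]; nlinarith [h2]
  have hcT : Periodic c (2 * Real.pi) := fun φ ↦ by simp only [hc, circlePoint_add_two_pi]
  have hsT : Periodic s (2 * Real.pi) := fun φ ↦ by simp only [hs, circlePoint_add_two_pi]
  obtain ⟨α, d, hα, hcos, hsin, hper⟩ := exists_contDiff_angle_periodic hcs hss hcs1 hcT hsT
  have hexpα : ∀ φ, Complex.exp (α φ * Complex.I) = f (circlePoint φ) := fun φ ↦ by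
    apply Complex.ext
    · rw [Complex.exp_ofReal_mul_I_re, hcos]
    · rw [Complex.exp_ofReal_mul_I_im, hsin]
  refine ⟨d, ?_⟩
  -- the interpolated angle and the periodic family
  set β : ℝ → ℝ → ℝ := fun t φ ↦ (1 - t) * α φ + t * (d * φ + α 0) with hβ
  have hβper : ∀ t φ, β t (φ + 2 * Real.pi) = β t φ + 2 * Real.pi * d := fun t φ ↦ by
    simp only [hβ, hper]; ring
  set P : ℝ → ℝ → Matrix (Fin 3) (Fin 3) ℝ := fun t φ ↦ rotC (Complex.exp (β t φ * Complex.I)) with hP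
  have hexpper : ∀ t φ, Complex.exp (β t (φ + 2 * Real.pi) * Complex.I) = Complex.exp (β t φ * Complex.I) := by
    intro t φ
    rw [hβper, Complex.ofReal_add, add_mul, Complex.exp_add]
    have : Complex.exp (((2 * Real.pi * d : ℝ) : ℂ) * Complex.I) = 1 := by
      have h := Complex.exp_int_mul_two_pi_mul_I d
      rw [← h]; congr 1; push_cast; ring
    rw [this, _root_.mul_one]
  have hPper : ∀ t, Periodic (P t) (2 * Real.pi) := fun t φ ↦ by simp only [hP, hexpper]
  have hentry : ∀ t i j, ContDiff ℝ ∞ fun φ ↦ P t φ i j := fun t i j ↦ by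
    have hβt : ContDiff ℝ ∞ (β t) := by simp only [hβ]; fun_prop
    have he : ContDiff ℝ ∞ fun φ ↦ Complex.exp (β t φ * Complex.I) :=
      Complex.contDiff_exp.comp ((Complex.ofRealCLM.contDiff.comp hβt).mul contDiff_const)
    exact (contDiff_rotC_entry i j).comp he
  have hPcont : Continuous fun p : ℝ × ℝ ↦ P p.1 p.2 := by
    refine continuous_rotC.comp (Complex.continuous_exp.comp ?_)
    have hαc := hα.continuous
    simp only [hβ]
    fun_prop
  -- the family of loops
  set G : ℝ → 𝕊 1 → (𝔼 3 →L[ℝ] 𝔼 3) := fun t u ↦ matCLM (descend (P t) u) with hG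
  have hGsmooth : ∀ t, ContMDiff (𝓡 1) 𝓘(ℝ, 𝔼 3 →L[ℝ] 𝔼 3) ∞ (G t) := fun t ↦
    contMDiff_matCLM_of_entries fun i j ↦ by
      show ContMDiff (𝓡 1) 𝓘(ℝ, ℝ) ∞ (descend fun φ ↦ P t φ i j)
      exact contMDiff_descend (fun φ ↦ by simp only [hPper t φ]) (hentry t i j)
  have hGunit : ∀ t u, IsUnit (G t u) := fun t u ↦ by
    obtain ⟨φ, rfl⟩ := circlePoint_surjective u
    simp only [hG, descend_circlePoint (hPper t)]
    exact isUnit_matCLM_rotC (norm_exp_ofReal_mul_I _)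
  have hGcont : Continuous fun p : ℝ × (𝕊 1) ↦ G p.1 p.2 :=
    continuous_matCLM.comp (continuous_descend_family hPper hPcont)
  -- the ends
  have hG0 : G 0 = (rotLoop f hf h1).toFun := by
    funext u
    obtain ⟨φ, rfl⟩ := circlePoint_surjective u
    show matCLM (descend (P 0) (circlePoint φ)) = matCLM (rotC (f (circlePoint φ)))
    rw [descend_circlePoint (hPper 0)]
    simp only [hP, hβ, sub_zero, _root_.one_mul, zero_mul, add_zero, hexpα]
  set w₀ : ℂ := Complex.exp (α 0 * Complex.I) with hw₀
  have hG1 : G 1 = ((rotLoop (fun _ ↦ w₀) contMDiff_const (fun _ ↦ norm_exp_ofReal_mul_I (α 0))).mul (twistPow d)).toFun := by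
    funext u
    obtain ⟨φ, rfl⟩ := circlePoint_surjective u
    show matCLM (descend (P 1) (circlePoint φ)) =
      matCLM (rotC w₀) * matCLM (rotC (toC ((circlePoint φ : 𝕊 1) : 𝔼 2) ^ d))
    rw [descend_circlePoint (hPper 1), ← matCLM_mul, ← rotC_mul]
    simp only [hP, hβ, sub_self, zero_mul, _root_.one_mul, zero_add]
    congr 2
    rw [toC_circlePoint, ← Complex.exp_int_mul, hw₀, ← Complex.exp_add]
    congr 1
    push_cast
    ring
  have hJ : Joined (rotLoop f hf h1)
      ((rotLoop (fun _ ↦ w₀) contMDiff_const (fun _ ↦ norm_exp_ofReal_mul_I (α 0))).mul (twistPow d)) :=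
    joined_of_family hGsmooth hGunit hGcont.continuousOn hG0 hG1
  have hphase := (joined_phase_one (α 0)).mul (Joined.refl (twistPow d))
  rw [one_mul] at hphase
  exact hJ.trans hphase


/-! ### Householder reflections and the rotation taking one unit vector to another -/

/-- **The Householder reflection** `w ↦ w - (2/‖v‖²) ⟪v, w⟫ v` in the plane orthogonal to `v`
(any `v`; the identity for `v = 0`). [folklore] -/
def hh (v : 𝔼 3) : 𝔼 3 →L[ℝ] 𝔼 3 :=
  ContinuousLinearMap.id ℝ (𝔼 3) - (2 / ‖v‖ ^ 2) • (innerSL ℝ v).smulRight v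

/-- The Householder reflection evaluated. [folklore] -/
theorem hh_apply (v w : 𝔼 3) : hh v w = w - ((2 / ‖v‖ ^ 2) * inner ℝ v w) • v := by
  simp [hh, mul_smul]

/-- `hh v v = -v` for `v ≠ 0`. [folklore] -/
theorem hh_self {v : 𝔼 3} (hv : v ≠ 0) : hh v v = -v := by
  rw [hh_apply, real_inner_self_eq_norm_sq]
  have h : ‖v‖ ^ 2 ≠ 0 := pow_ne_zero 2 (norm_ne_zero_iff.2 hv)
  rw [div_mul_cancel₀ _ h, two_smul]
  abel

/-- **The Householder reflection is an involution** (`v ≠ 0`). [folklore] -/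
theorem hh_mul_hh {v : 𝔼 3} (hv : v ≠ 0) : hh v * hh v = 1 := by
  have h : ‖v‖ ^ 2 ≠ 0 := pow_ne_zero 2 (norm_ne_zero_iff.2 hv)
  refine ContinuousLinearMap.ext fun w ↦ ?_
  have key : hh v (hh v w) = w := by
    rw [hh_apply, hh_apply, inner_sub_right, real_inner_smul_right, real_inner_self_eq_norm_sq]
    have : 2 / ‖v‖ ^ 2 * (inner ℝ v w - 2 / ‖v‖ ^ 2 * inner ℝ v w * ‖v‖ ^ 2) = -(2 / ‖v‖ ^ 2 * inner ℝ v w) := by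
      field_simp; ring
    rw [this, neg_smul, sub_neg_eq_add, sub_add_cancel]
  exact key

/-- The Householder reflection is a unit (`v ≠ 0`). [folklore] -/
theorem isUnit_hh {v : 𝔼 3} (hv : v ≠ 0) : IsUnit (hh v) :=
  ⟨⟨hh v, hh v, hh_mul_hh hv, hh_mul_hh hv⟩, rfl⟩

/-- The Householder reflection only depends on the line of `v`: `hh (c • v) = hh v`, `c ≠ 0`. [folklore] -/
theorem hh_smul {c : ℝ} (hc : c ≠ 0) (v : 𝔼 3) : hh (c • v) = hh v := by
  refine ContinuousLinearMap.ext fun w ↦ ?_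
  rw [hh_apply, hh_apply, real_inner_smul_left, norm_smul, mul_pow, Real.norm_eq_abs, sq_abs, smul_smul]
  by_cases hv : v = 0
  · simp [hv]
  · have h : ‖v‖ ^ 2 ≠ 0 := pow_ne_zero 2 (norm_ne_zero_iff.2 hv)
    congr 1
    field_simp

/-- **`hh (x + y)` takes `-x` to `y`** for unit vectors `x`, `y` with `x + y ≠ 0` (reflection in
the bisecting plane). [folklore] -/
theorem hh_add_neg {x y : 𝔼 3} (hx : ‖x‖ = 1) (hy : ‖y‖ = 1) (hxy : x + y ≠ 0) : hh (x + y) (-x) = y := by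
  rw [hh_apply, inner_neg_right, inner_add_left, real_inner_self_eq_norm_sq, hx, real_inner_comm x y]
  have hn : ‖x + y‖ ^ 2 = 2 + 2 * inner ℝ x y := by
    have h0 := norm_add_sq_real x y
    rw [hx, hy] at h0
    linarith
  have hne : ‖x + y‖ ^ 2 ≠ 0 := pow_ne_zero 2 (norm_ne_zero_iff.2 hxy)
  have hc : 1 + inner ℝ x y ≠ 0 := by
    intro h0
    apply hne
    rw [hn]; linarith
  have hk : 2 / ‖x + y‖ ^ 2 * -(1 ^ 2 + inner ℝ x y) = -1 := by
    rw [hn]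
    field_simp
  rw [hk, neg_one_smul, sub_neg_eq_add, neg_add_cancel_left]

/-- **The rotation `hh (x + y) ∘ hh x` takes `x` to `y`** (unit `x`, `y`, `x + y ≠ 0`). [folklore] -/
theorem hh_add_mul_hh_apply {x y : 𝔼 3} (hx : ‖x‖ = 1) (hy : ‖y‖ = 1) (hxy : x + y ≠ 0) :
    (hh (x + y) * hh x) x = y := by
  show hh (x + y) (hh x x) = y
  rw [hh_self (by rw [← norm_ne_zero_iff, hx]; exact one_ne_zero), hh_add_neg hx hy hxy]

/-- **The Householder reflection depends smoothly on `v ≠ 0`.** [folklore] -/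
theorem contDiffAt_hh {v : 𝔼 3} (hv : v ≠ 0) : ContDiffAt ℝ ∞ hh v := by
  have h1 : ContDiffAt ℝ ∞ (fun v : 𝔼 3 ↦ 2 / ‖v‖ ^ 2) v := by
    refine contDiffAt_const.div ((contDiff_norm_sq ℝ).contDiffAt) (pow_ne_zero 2 (norm_ne_zero_iff.2 hv))
  have h2 : ContDiff ℝ ∞ fun v : 𝔼 3 ↦ (innerSL ℝ v).smulRight v :=
    (isBoundedBilinearMap_smulRight (𝕜 := ℝ) (E := 𝔼 3) (F := 𝔼 3)).contDiff.comp
      ((innerSL ℝ : 𝔼 3 →L[ℝ] 𝔼 3 →L[ℝ] ℝ).contDiff.prodMk contDiff_id)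
  exact contDiffAt_const.sub (h1.smul h2.contDiffAt)

/-- The Householder reflection depends continuously on `v ≠ 0`. [folklore] -/
theorem continuousAt_hh {v : 𝔼 3} (hv : v ≠ 0) : ContinuousAt hh v := (contDiffAt_hh hv).continuousAt


/-! ### Step A — turning the third column of a loop into a constant direction -/

/-- The third basis vector `e₂`. [folklore] -/
def e2 : 𝔼 3 := EuclideanSpace.single 2 1

/-- `‖e₂‖ = 1`. [folklore] -/
@[simp] theorem norm_e2 : ‖e2‖ = 1 := by simp [e2]

section StepA

variable (L : OpLoop)

/-- **The third column** `a(u) = L_u e₂` of the loop. [folklore] -/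
def col (u : 𝕊 1) : 𝔼 3 := L.toFun u e2

/-- The third column never vanishes. [folklore] -/
theorem col_ne_zero (u : 𝕊 1) : L.col u ≠ 0 := by
  intro h
  have h1 : L.inv u (L.toFun u e2) = e2 := L.inv_apply_apply u e2
  rw [col] at h
  rw [h, map_zero] at h1
  have : ‖(e2 : 𝔼 3)‖ = 0 := by rw [← h1, norm_zero]
  simp at this

/-- The third column is smooth. [folklore] -/
theorem contMDiff_col : ContMDiff (𝓡 1) 𝓘(ℝ, 𝔼 3) ∞ L.col := L.contMDiff_toFun.clm_apply contMDiff_const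

/-- **The direction** `x(u) = a(u)/‖a(u)‖` of the third column. [folklore] -/
def dir (u : 𝕊 1) : 𝔼 3 := ‖L.col u‖⁻¹ • L.col u

/-- The direction is a unit vector. [folklore] -/
theorem norm_dir (u : 𝕊 1) : ‖L.dir u‖ = 1 := by
  rw [dir, norm_smul, norm_inv, norm_norm, inv_mul_cancel₀ (norm_ne_zero_iff.2 (L.col_ne_zero u))]

/-- `a(u) = ‖a(u)‖ x(u)`. [folklore] -/
theorem col_eq_smul_dir (u : 𝕊 1) : L.col u = ‖L.col u‖ • L.dir u := by
  rw [dir, smul_smul, mul_inv_cancel₀ (norm_ne_zero_iff.2 (L.col_ne_zero u)), one_smul]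

/-- The direction is smooth. [folklore] -/
theorem contMDiff_dir : ContMDiff (𝓡 1) 𝓘(ℝ, 𝔼 3) ∞ L.dir := by
  have h1 : ContMDiff (𝓡 1) 𝓘(ℝ, ℝ) ∞ fun u ↦ ‖L.col u‖⁻¹ := fun u ↦
    (ContDiffAt.comp_contMDiffAt (g := fun v : 𝔼 3 ↦ ‖v‖) (f := L.col) (contDiffAt_norm ℝ (L.col_ne_zero u))
      (L.contMDiff_col u)).inv₀ (norm_ne_zero_iff.2 (L.col_ne_zero u))
  exact h1.smul L.contMDiff_col

/-- **The direction misses a point of the sphere** (a smooth curve on `𝕊²`). [cite: HirschDT1976, Ch. 3 §1 Prop. 1.2] -/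
theorem exists_dir_ne : ∃ m : 𝔼 3, ‖m‖ = 1 ∧ ∀ u, L.dir u ≠ m := by
  haveI := Fact.mk (@finrank_euclideanSpace_fin ℝ _ 3)
  set g : 𝕊 1 → 𝕊 2 := fun u ↦ ⟨L.dir u, by rw [mem_sphere_zero_iff_norm, L.norm_dir]⟩ with hg
  have hgs : ContMDiff (𝓡 1) (𝓡 2) 1 g :=
    (L.contMDiff_dir.of_le (by norm_cast)).codRestrict_sphere fun u ↦ by
      rw [mem_sphere_zero_iff_norm]; exact L.norm_dir u
  obtain ⟨q, hq⟩ := exists_notMem_range_of_contMDiff (by norm_num) hgs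
  refine ⟨q, norm_eq_of_mem_sphere q, fun u h ↦ hq ⟨u, Subtype.ext h⟩⟩

end StepA

/-! ### The rotation field of a unit vector field missing a point -/

section RotField

variable (x : 𝕊 1 → 𝔼 3) (m : 𝔼 3)

/-- **The straight segment** `(1 - t) x(u) - t m` from a unit vector field `x` to the antipode
`-m` of a point `m` it misses (never zero). [folklore] -/
def seg (t : ℝ) (u : 𝕊 1) : 𝔼 3 := (1 - t) • x u - t • m

/-- Two distinct, non-antipodal unit vectors are linearly independent. [folklore] -/
theorem eq_zero_of_smul_eq_smul {x y : 𝔼 3} (hx : ‖x‖ = 1) (hy : ‖y‖ = 1) (h₁ : x ≠ y) (h₂ : x ≠ -y)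
    {a b : ℝ} (h : a • x = b • y) : a = 0 ∧ b = 0 := by
  by_cases ha : a = 0
  · subst ha
    rw [zero_smul, eq_comm, smul_eq_zero] at h
    rcases h with h | h
    · exact ⟨rfl, h⟩
    · exfalso; rw [h, norm_zero] at hy; exact zero_ne_one hy
  · exfalso
    have hn : |a| = |b| := by
      have := congrArg norm h
      rwa [norm_smul, norm_smul, hx, hy, _root_.mul_one, _root_.mul_one, Real.norm_eq_abs, Real.norm_eq_abs] at this
    have hx' : x = (b / a) • y := by
      rw [div_eq_inv_mul, mul_smul, ← h, smul_smul, inv_mul_cancel₀ ha, one_smul]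
    rcases abs_eq_abs.1 hn.symm with hb | hb
    · rw [hb, div_self ha, one_smul] at hx'; exact h₁ hx'
    · rw [hb, neg_div, div_self ha, neg_one_smul] at hx'; exact h₂ hx'

variable {x m}

/-- The segment never vanishes (unit `x(u) ≠ m`, unit `m`). [folklore] -/
theorem seg_ne_zero (hx1 : ∀ u, ‖x u‖ = 1) (hm : ‖m‖ = 1) (hmiss : ∀ u, x u ≠ m) (t : ℝ) (u : 𝕊 1) :
    seg x m t u ≠ 0 := by
  intro h0
  rw [seg, sub_eq_zero] at h0
  by_cases hneg : x u = -m
  · rw [hneg, smul_neg, neg_eq_iff_eq_neg, ← neg_smul] at h0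
    have := congrArg (fun v ↦ inner ℝ m v) h0
    simp only [inner_smul_right, real_inner_self_eq_norm_sq, hm, one_pow, _root_.mul_one] at this
    linarith
  · obtain ⟨h1, h2⟩ := eq_zero_of_smul_eq_smul (hx1 u) hm (hmiss u) hneg h0
    linarith

variable (x m) in
/-- **The direction of the segment** `x_t(u)`. [folklore] -/
def dirT (t : ℝ) (u : 𝕊 1) : 𝔼 3 := ‖seg x m t u‖⁻¹ • seg x m t u

/-- `x_t(u)` is a unit vector. [folklore] -/
theorem norm_dirT (hx1 : ∀ u, ‖x u‖ = 1) (hm : ‖m‖ = 1) (hmiss : ∀ u, x u ≠ m) (t : ℝ) (u : 𝕊 1) :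
    ‖dirT x m t u‖ = 1 := by
  rw [dirT, norm_smul, norm_inv, norm_norm, inv_mul_cancel₀ (norm_ne_zero_iff.2 (seg_ne_zero hx1 hm hmiss t u))]

/-- At `t = 0` the direction of the segment is `x(u)`. [folklore] -/
theorem dirT_zero (hx1 : ∀ u, ‖x u‖ = 1) (u : 𝕊 1) : dirT x m 0 u = x u := by
  simp [dirT, seg, hx1 u]

/-- At `t = 1` the direction of the segment is `-m`. [folklore] -/
theorem dirT_one (hm : ‖m‖ = 1) (u : 𝕊 1) : dirT x m 1 u = -m := by
  simp [dirT, seg, hm]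

/-- **`x(u)` and `x_t(u)` are never antipodal.** [folklore] -/
theorem add_dirT_ne_zero (hx1 : ∀ u, ‖x u‖ = 1) (hm : ‖m‖ = 1) (hmiss : ∀ u, x u ≠ m) (t : ℝ) (u : 𝕊 1) :
    x u + dirT x m t u ≠ 0 := by
  intro h0
  have hs := seg_ne_zero hx1 hm hmiss t u
  set r := ‖seg x m t u‖ with hr
  have hr0 : 0 < r := norm_pos_iff.2 hs
  have h1 : (r + (1 - t)) • x u = t • m := by
    have h2 : r • (x u + dirT x m t u) = 0 := by rw [h0, smul_zero]
    rw [smul_add, dirT, smul_smul, mul_inv_cancel₀ hr0.ne', one_smul, seg] at h2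
    rw [add_smul]
    have : r • x u + ((1 - t) • x u - t • m) = (r • x u + (1 - t) • x u) - t • m := by abel
    rw [this, sub_eq_zero] at h2
    exact h2
  by_cases hneg : x u = -m
  · rw [hneg, smul_neg, neg_eq_iff_eq_neg, ← neg_smul] at h1
    have := congrArg (fun v ↦ inner ℝ m v) h1
    simp only [inner_smul_right, real_inner_self_eq_norm_sq, hm, one_pow, _root_.mul_one] at this
    linarith
  · obtain ⟨h2, h3⟩ := eq_zero_of_smul_eq_smul (hx1 u) hm (hmiss u) hneg h1
    linarith

variable (x m) in
/-- **The rotation field** `R_t(u) = hh(x(u) + x_t(u)) ∘ hh(x(u))`, taking `x(u)` to `x_t(u)`. [folklore] -/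
def rotF (t : ℝ) (u : 𝕊 1) : 𝔼 3 →L[ℝ] 𝔼 3 := hh (x u + dirT x m t u) * hh (x u)

/-- At `t = 0` the rotation field is the identity. [folklore] -/
theorem rotF_zero (hx1 : ∀ u, ‖x u‖ = 1) (u : 𝕊 1) : rotF x m 0 u = 1 := by
  have hd : x u ≠ 0 := by rw [← norm_ne_zero_iff, hx1]; exact one_ne_zero
  rw [rotF, dirT_zero hx1, ← two_smul ℝ (x u), hh_smul two_ne_zero, hh_mul_hh hd]

/-- **At `t = 1` the rotation field takes `x(u)` to `-m`.** [folklore] -/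
theorem rotF_one_apply (hx1 : ∀ u, ‖x u‖ = 1) (hm : ‖m‖ = 1) (hmiss : ∀ u, x u ≠ m) (u : 𝕊 1) :
    rotF x m 1 u (x u) = -m := by
  rw [rotF, hh_add_mul_hh_apply (hx1 u) (norm_dirT hx1 hm hmiss 1 u) (add_dirT_ne_zero hx1 hm hmiss 1 u),
    dirT_one hm]

/-- The rotation field consists of units. [folklore] -/
theorem isUnit_rotF (hx1 : ∀ u, ‖x u‖ = 1) (hm : ‖m‖ = 1) (hmiss : ∀ u, x u ≠ m) (t : ℝ) (u : 𝕊 1) :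
    IsUnit (rotF x m t u) := by
  have hd : x u ≠ 0 := by rw [← norm_ne_zero_iff, hx1]; exact one_ne_zero
  exact (isUnit_hh (add_dirT_ne_zero hx1 hm hmiss t u)).mul (isUnit_hh hd)

/-- The segment is smooth in `u`. [folklore] -/
theorem contMDiff_seg (hxs : ContMDiff (𝓡 1) 𝓘(ℝ, 𝔼 3) ∞ x) (t : ℝ) : ContMDiff (𝓡 1) 𝓘(ℝ, 𝔼 3) ∞ (seg x m t) := by
  have h1 : ContMDiff (𝓡 1) 𝓘(ℝ, ℝ) ∞ fun _ : 𝕊 1 ↦ (1 - t) := contMDiff_const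
  have h2 : ContMDiff (𝓡 1) 𝓘(ℝ, 𝔼 3) ∞ fun _ : 𝕊 1 ↦ t • m := contMDiff_const
  exact (h1.smul hxs).sub h2

/-- The direction of the segment is smooth in `u`. [folklore] -/
theorem contMDiff_dirT (hx1 : ∀ u, ‖x u‖ = 1) (hxs : ContMDiff (𝓡 1) 𝓘(ℝ, 𝔼 3) ∞ x) (hm : ‖m‖ = 1)
    (hmiss : ∀ u, x u ≠ m) (t : ℝ) : ContMDiff (𝓡 1) 𝓘(ℝ, 𝔼 3) ∞ (dirT x m t) := by
  have h1 : ContMDiff (𝓡 1) 𝓘(ℝ, ℝ) ∞ fun u ↦ ‖seg x m t u‖⁻¹ := fun u ↦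
    (ContDiffAt.comp_contMDiffAt (g := fun v : 𝔼 3 ↦ ‖v‖) (f := seg x m t)
      (contDiffAt_norm ℝ (seg_ne_zero hx1 hm hmiss t u)) (contMDiff_seg hxs t u)).inv₀
      (norm_ne_zero_iff.2 (seg_ne_zero hx1 hm hmiss t u))
  exact h1.smul (contMDiff_seg hxs t)

/-- **The rotation field is smooth in `u`.** [folklore] -/
theorem contMDiff_rotF (hx1 : ∀ u, ‖x u‖ = 1) (hxs : ContMDiff (𝓡 1) 𝓘(ℝ, 𝔼 3) ∞ x) (hm : ‖m‖ = 1)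
    (hmiss : ∀ u, x u ≠ m) (t : ℝ) : ContMDiff (𝓡 1) 𝓘(ℝ, 𝔼 3 →L[ℝ] 𝔼 3) ∞ (rotF x m t) := by
  have hd : ∀ u, x u ≠ 0 := fun u ↦ by rw [← norm_ne_zero_iff, hx1]; exact one_ne_zero
  have h1 : ContMDiff (𝓡 1) 𝓘(ℝ, 𝔼 3 →L[ℝ] 𝔼 3) ∞ fun u ↦ hh (x u + dirT x m t u) := fun u ↦
    ContDiffAt.comp_contMDiffAt (g := hh) (f := fun u ↦ x u + dirT x m t u)
      (contDiffAt_hh (add_dirT_ne_zero hx1 hm hmiss t u)) ((hxs.add (contMDiff_dirT hx1 hxs hm hmiss t)) u)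
  have h2 : ContMDiff (𝓡 1) 𝓘(ℝ, 𝔼 3 →L[ℝ] 𝔼 3) ∞ fun u ↦ hh (x u) := fun u ↦
    ContDiffAt.comp_contMDiffAt (g := hh) (f := x) (contDiffAt_hh (hd u)) (hxs u)
  exact (contDiff_mul (𝔸 := 𝔼 3 →L[ℝ] 𝔼 3) (n := ∞)).comp_contMDiff (h1.prodMk_space h2)

/-- **The rotation field is jointly continuous.** [folklore] -/
theorem continuous_rotF (hx1 : ∀ u, ‖x u‖ = 1) (hxs : ContMDiff (𝓡 1) 𝓘(ℝ, 𝔼 3) ∞ x) (hm : ‖m‖ = 1)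
    (hmiss : ∀ u, x u ≠ m) : Continuous fun p : ℝ × (𝕊 1) ↦ rotF x m p.1 p.2 := by
  have hd : ∀ u, x u ≠ 0 := fun u ↦ by rw [← norm_ne_zero_iff, hx1]; exact one_ne_zero
  have hdir : Continuous fun p : ℝ × (𝕊 1) ↦ x p.2 := hxs.continuous.comp continuous_snd
  have hseg : Continuous fun p : ℝ × (𝕊 1) ↦ seg x m p.1 p.2 := by
    unfold seg
    exact ((continuous_const.sub continuous_fst).smul hdir).sub (continuous_fst.smul continuous_const)
  have hdirT : Continuous fun p : ℝ × (𝕊 1) ↦ dirT x m p.1 p.2 := by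
    have hn : Continuous fun p : ℝ × (𝕊 1) ↦ ‖seg x m p.1 p.2‖⁻¹ :=
      (continuous_norm.comp hseg).inv₀ fun p ↦ norm_ne_zero_iff.2 (seg_ne_zero hx1 hm hmiss p.1 p.2)
    exact hn.smul hseg
  have hsum : Continuous fun p : ℝ × (𝕊 1) ↦ x p.2 + dirT x m p.1 p.2 := hdir.add hdirT
  have h1 : Continuous fun p : ℝ × (𝕊 1) ↦ hh (x p.2 + dirT x m p.1 p.2) :=
    continuous_iff_continuousAt.2 fun p ↦
      ContinuousAt.comp (f := fun p : ℝ × (𝕊 1) ↦ x p.2 + dirT x m p.1 p.2)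
        (continuousAt_hh (add_dirT_ne_zero hx1 hm hmiss p.1 p.2)) hsum.continuousAt
  have h2 : Continuous fun p : ℝ × (𝕊 1) ↦ hh (x p.2) :=
    continuous_iff_continuousAt.2 fun p ↦
      ContinuousAt.comp (f := fun p : ℝ × (𝕊 1) ↦ x p.2) (continuousAt_hh (hd p.2)) hdir.continuousAt
  exact h1.mul h2

/-- **Turning a unit vector field to a constant by a family of rotations of the loop**: if the
third columns of `L` are `r(u) x(u)` for a smooth unit vector field `x` missing the unit vector
`m`, then `L` is joined to a loop whose third columns are `r(u) (-m)`. [folklore] -/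
theorem exists_joined_of_col_eq_smul (L : OpLoop) (hx1 : ∀ u, ‖x u‖ = 1) (hxs : ContMDiff (𝓡 1) 𝓘(ℝ, 𝔼 3) ∞ x)
    (hm : ‖m‖ = 1) (hmiss : ∀ u, x u ≠ m) {r : 𝕊 1 → ℝ} (hcol : ∀ u, L.toFun u e2 = r u • x u) :
    ∃ L₁ : OpLoop, Joined L L₁ ∧ ∀ u, L₁.toFun u e2 = r u • (-m) := by
  set F : ℝ → 𝕊 1 → (𝔼 3 →L[ℝ] 𝔼 3) := fun t u ↦ rotF x m t u * L.toFun u with hF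
  have hFs : ∀ t, ContMDiff (𝓡 1) 𝓘(ℝ, 𝔼 3 →L[ℝ] 𝔼 3) ∞ (F t) := fun t ↦
    (contDiff_mul (𝔸 := 𝔼 3 →L[ℝ] 𝔼 3) (n := ∞)).comp_contMDiff
      ((contMDiff_rotF hx1 hxs hm hmiss t).prodMk_space L.contMDiff_toFun)
  have hFu : ∀ t u, IsUnit (F t u) := fun t u ↦ (isUnit_rotF hx1 hm hmiss t u).mul (L.isUnit_toFun u)
  have hFc : Continuous fun p : ℝ × (𝕊 1) ↦ F p.1 p.2 :=
    (continuous_rotF hx1 hxs hm hmiss).mul (L.contMDiff_toFun.continuous.comp continuous_snd)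
  have hF0 : F 0 = L.toFun := funext fun u ↦ by simp only [hF, rotF_zero hx1, _root_.one_mul]
  refine ⟨ofUnits (F 1) (hFs 1) (hFu 1), joined_of_family hFs hFu hFc.continuousOn hF0 rfl, fun u ↦ ?_⟩
  rw [ofUnits_toFun]
  show rotF x m 1 u (L.toFun u e2) = r u • (-m)
  rw [hcol, map_smul, rotF_one_apply hx1 hm hmiss]

end RotField

/-! ### Step A assembled: the third column can be turned to `e₂` -/

section StepA'

/-- `e₀`. [folklore] -/
def e0 : 𝔼 3 := EuclideanSpace.single 0 1

/-- `‖e₀‖ = 1`. [folklore] -/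
@[simp] theorem norm_e0 : ‖e0‖ = 1 := by simp [e0]

/-- `e₀ ≠ -e₂` and friends: distinct basis vectors are not antipodal. [folklore] -/
theorem e0_ne_neg_e2 : e0 ≠ -e2 := by
  intro h
  have := congrArg (fun v : 𝔼 3 ↦ v 0) h
  simp [e0, e2] at this

/-- `-e₂ ≠ -e₀`. [folklore] -/
theorem neg_e2_ne_neg_e0 : -e2 ≠ -e0 := by
  intro h
  have := congrArg (fun v : 𝔼 3 ↦ v 0) h
  simp [e0, e2] at this

/-- **Step A.** Every loop is joined to a loop whose third columns are positive multiples of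
`e₂`: `L ∼ L₁` with `L₁ u e₂ = ‖L u e₂‖ e₂`. [folklore] -/
theorem exists_joined_col_e2 (L : OpLoop) :
    ∃ L₁ : OpLoop, Joined L L₁ ∧ ∀ u, L₁.toFun u e2 = ‖L.col u‖ • e2 := by
  -- first make the direction constant, `-m`
  obtain ⟨m, hm, hmiss⟩ := L.exists_dir_ne
  obtain ⟨L₁, hJ₁, hcol₁⟩ := exists_joined_of_col_eq_smul (x := L.dir) (m := m) L L.norm_dir L.contMDiff_dir hm hmiss
    (r := fun u ↦ ‖L.col u‖) (fun u ↦ L.col_eq_smul_dir u)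
  have hnm : ‖-m‖ = 1 := by rw [norm_neg, hm]
  by_cases hq : -m = -e2
  · -- direction `-e₂`: go through `e₀`
    have hmiss₂ : ∀ u : 𝕊 1, (fun _ ↦ -m) u ≠ -e0 := fun u ↦ by rw [hq]; exact neg_e2_ne_neg_e0
    obtain ⟨L₂, hJ₂, hcol₂⟩ := exists_joined_of_col_eq_smul (x := fun _ ↦ -m) (m := -e0) L₁ (fun _ ↦ hnm)
      contMDiff_const (by rw [norm_neg, norm_e0]) hmiss₂ hcol₁
    simp only [neg_neg] at hcol₂
    have hmiss₃ : ∀ u : 𝕊 1, (fun _ ↦ e0) u ≠ -e2 := fun _ ↦ e0_ne_neg_e2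
    obtain ⟨L₃, hJ₃, hcol₃⟩ := exists_joined_of_col_eq_smul (x := fun _ ↦ e0) (m := -e2) L₂ (fun _ ↦ norm_e0)
      contMDiff_const (by rw [norm_neg, norm_e2]) hmiss₃ hcol₂
    simp only [neg_neg] at hcol₃
    exact ⟨L₃, (hJ₁.trans hJ₂).trans hJ₃, hcol₃⟩
  · have hmiss₂ : ∀ u : 𝕊 1, (fun _ ↦ -m) u ≠ -e2 := fun _ ↦ hq
    obtain ⟨L₂, hJ₂, hcol₂⟩ := exists_joined_of_col_eq_smul (x := fun _ ↦ -m) (m := -e2) L₁ (fun _ ↦ hnm)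
      contMDiff_const (by rw [norm_neg, norm_e2]) hmiss₂ hcol₁
    simp only [neg_neg] at hcol₂
    exact ⟨L₂, hJ₁.trans hJ₂, hcol₂⟩

end StepA'


/-! ### Right multiplication by a family of units -/

/-- **Joining by right multiplication**: if `D_t(u)` is a jointly continuous family of smooth
unit-valued loops with `D_0 = 1`, then `L ∼ (u ↦ L_u ∘ D_1(u))`. [folklore] -/
theorem exists_joined_mul_right (L : OpLoop) {D : ℝ → 𝕊 1 → (𝔼 3 →L[ℝ] 𝔼 3)}
    (hDs : ∀ t, ContMDiff (𝓡 1) 𝓘(ℝ, 𝔼 3 →L[ℝ] 𝔼 3) ∞ (D t)) (hDu : ∀ t u, IsUnit (D t u))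
    (hDc : Continuous fun p : ℝ × (𝕊 1) ↦ D p.1 p.2) (hD0 : ∀ u, D 0 u = 1) :
    ∃ L₁ : OpLoop, Joined L L₁ ∧ ∀ u, L₁.toFun u = L.toFun u * D 1 u := by
  set F : ℝ → 𝕊 1 → (𝔼 3 →L[ℝ] 𝔼 3) := fun t u ↦ L.toFun u * D t u with hF
  have hFs : ∀ t, ContMDiff (𝓡 1) 𝓘(ℝ, 𝔼 3 →L[ℝ] 𝔼 3) ∞ (F t) := fun t ↦
    (contDiff_mul (𝔸 := 𝔼 3 →L[ℝ] 𝔼 3) (n := ∞)).comp_contMDiff (L.contMDiff_toFun.prodMk_space (hDs t))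
  have hFu : ∀ t u, IsUnit (F t u) := fun t u ↦ (L.isUnit_toFun u).mul (hDu t u)
  have hFc : Continuous fun p : ℝ × (𝕊 1) ↦ F p.1 p.2 :=
    (L.contMDiff_toFun.continuous.comp continuous_snd).mul hDc
  have hF0 : F 0 = L.toFun := funext fun u ↦ by simp only [hF, hD0, _root_.mul_one]
  exact ⟨ofUnits (F 1) (hFs 1) (hFu 1), joined_of_family hFs hFu hFc.continuousOn hF0 rfl, fun u ↦ rfl⟩

/-! ### Step B — normalising the third column and clearing the third row -/

section StepB

/-- The orthogonal projection onto `e₂`: `P₂ v = ⟪e₂, v⟫ e₂`. [folklore] -/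
def P2 : 𝔼 3 →L[ℝ] 𝔼 3 := (innerSL ℝ e2).smulRight e2

/-- `P₂` evaluated. [folklore] -/
theorem P2_apply (v : 𝔼 3) : P2 v = inner ℝ e2 v • e2 := rfl

/-- `⟪e₂, e₂⟫ = 1`. [folklore] -/
theorem inner_e2_e2 : inner ℝ e2 e2 = (1 : ℝ) := by
  rw [real_inner_self_eq_norm_sq, norm_e2, one_pow]

/-- `P₂ e₂ = e₂`. [folklore] -/
@[simp] theorem P2_e2 : P2 e2 = e2 := by rw [P2_apply, inner_e2_e2, one_smul]

/-- `P₂` is idempotent. [folklore] -/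
theorem P2_mul_P2 : P2 * P2 = P2 := by
  refine ContinuousLinearMap.ext fun v ↦ ?_
  show P2 (P2 v) = P2 v
  rw [P2_apply v, map_smul, P2_e2]

/-- **The scaling `id + (c - 1) P₂` of the `e₂`-direction** (`e₂ ↦ c e₂`, identity on `e₂ᗮ`). [folklore] -/
def scaleOp (c : ℝ) : 𝔼 3 →L[ℝ] 𝔼 3 := 1 + (c - 1) • P2

/-- The scaling evaluated. [folklore] -/
theorem scaleOp_apply (c : ℝ) (v : 𝔼 3) : scaleOp c v = v + ((c - 1) * inner ℝ e2 v) • e2 := by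
  simp only [scaleOp, mul_smul]
  rfl

/-- The scalings multiply. [folklore] -/
theorem scaleOp_mul (c c' : ℝ) : scaleOp c * scaleOp c' = scaleOp (c * c') := by
  refine ContinuousLinearMap.ext fun v ↦ ?_
  show scaleOp c (scaleOp c' v) = scaleOp (c * c') v
  rw [scaleOp_apply, scaleOp_apply, scaleOp_apply, inner_add_right, real_inner_smul_right, inner_e2_e2, _root_.mul_one,
    add_assoc, ← add_smul]
  congr 2
  ring

/-- `scaleOp 1 = 1`. [folklore] -/
@[simp] theorem scaleOp_one : scaleOp 1 = 1 := by
  refine ContinuousLinearMap.ext fun v ↦ ?_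
  rw [scaleOp_apply, sub_self, zero_mul, zero_smul, add_zero]
  rfl

/-- The scaling is a unit for `c ≠ 0`. [folklore] -/
theorem isUnit_scaleOp {c : ℝ} (hc : c ≠ 0) : IsUnit (scaleOp c) :=
  ⟨⟨scaleOp c, scaleOp c⁻¹, by rw [scaleOp_mul, mul_inv_cancel₀ hc, scaleOp_one],
    by rw [scaleOp_mul, inv_mul_cancel₀ hc, scaleOp_one]⟩, rfl⟩

/-- `scaleOp c e₂ = c e₂`. [folklore] -/
theorem scaleOp_e2 (c : ℝ) : scaleOp c e2 = c • e2 := by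
  rw [scaleOp_apply, inner_e2_e2, _root_.mul_one]
  module

/-- `c ↦ scaleOp c` is smooth (affine). [folklore] -/
theorem contDiff_scaleOp : ContDiff ℝ ∞ scaleOp := by
  unfold scaleOp
  exact contDiff_const.add ((contDiff_id.sub contDiff_const).smul contDiff_const)

/-- **Step B₁.** If `L u e₂ = ρ(u) e₂` with `ρ` smooth and positive, then `L` is joined to a loop
fixing `e₂`. [folklore] -/
theorem exists_joined_apply_e2_eq (L : OpLoop) {ρ : 𝕊 1 → ℝ} (hρ : ContMDiff (𝓡 1) 𝓘(ℝ, ℝ) ∞ ρ)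
    (hρ0 : ∀ u, 0 < ρ u) (hcol : ∀ u, L.toFun u e2 = ρ u • e2) :
    ∃ L₁ : OpLoop, Joined L L₁ ∧ ∀ u, L₁.toFun u e2 = e2 := by
  set c : ℝ → 𝕊 1 → ℝ := fun t u ↦ (1 - t) + t * (ρ u)⁻¹ with hc
  have hcs : ∀ t, ContMDiff (𝓡 1) 𝓘(ℝ, ℝ) ∞ (c t) := fun t ↦
    contMDiff_const.add (contMDiff_const.mul (ContMDiff.inv₀ hρ fun u ↦ (hρ0 u).ne'))
  have hcc : Continuous fun p : ℝ × (𝕊 1) ↦ c p.1 p.2 := by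
    have h1 : Continuous fun p : ℝ × (𝕊 1) ↦ (ρ p.2)⁻¹ :=
      (hρ.continuous.comp continuous_snd).inv₀ fun p ↦ (hρ0 p.2).ne'
    simp only [hc]
    fun_prop
  -- units for ALL `t`: off `[0, 1]` the coefficient may vanish, so clamp `t` into `[0, 1]`
  set c' : ℝ → 𝕊 1 → ℝ := fun t u ↦ c (max 0 (min t 1)) u with hc'
  have hc'pos : ∀ t u, 0 < c' t u := fun t u ↦ by
    simp only [hc', hc]
    have h0 : 0 ≤ max 0 (min t 1) := le_max_left _ _
    have h1 : max 0 (min t 1) ≤ 1 := max_le zero_le_one (min_le_right _ _)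
    have hρi : 0 < (ρ u)⁻¹ := inv_pos.2 (hρ0 u)
    have hprod : 0 ≤ max 0 (min t 1) * (ρ u)⁻¹ := mul_nonneg h0 hρi.le
    rcases eq_or_lt_of_le h1 with h | h
    · rw [h] at hprod ⊢; linarith
    · linarith
  obtain ⟨L₁, hJ, hL₁⟩ := L.exists_joined_mul_right (D := fun t u ↦ scaleOp (c' t u))
    (fun t ↦ contDiff_scaleOp.comp_contMDiff (hcs _)) (fun t u ↦ isUnit_scaleOp (hc'pos t u).ne')
    (contDiff_scaleOp.continuous.comp (hcc.comp ((continuous_const.max (continuous_fst.min continuous_const)).prodMk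
      continuous_snd)))
    (fun u ↦ by simp [hc', hc])
  refine ⟨L₁, hJ, fun u ↦ ?_⟩
  rw [hL₁]
  show L.toFun u (scaleOp (c' 1 u) e2) = e2
  have : c' 1 u = (ρ u)⁻¹ := by simp [hc', hc]
  rw [scaleOp_e2, map_smul, hcol, smul_smul, this, inv_mul_cancel₀ (hρ0 u).ne', one_smul]

/-- **The shear functional** `φ_N(v) = ⟪e₂, N(v - ⟪e₂, v⟫ e₂)⟫`: the `e₂`-component of `N` on the
horizontal part of `v`. [folklore] -/
def shearFun (N : 𝔼 3 →L[ℝ] 𝔼 3) : 𝔼 3 →L[ℝ] ℝ := (innerSL ℝ e2).comp (N.comp (1 - P2))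

/-- The shear functional kills `e₂`. [folklore] -/
theorem shearFun_e2 (N : 𝔼 3 →L[ℝ] 𝔼 3) : shearFun N e2 = 0 := by
  simp [shearFun, P2_e2]

/-- **The shear operator** `K_N v = φ_N(v) e₂` (square zero). [folklore] -/
def shearK (N : 𝔼 3 →L[ℝ] 𝔼 3) : 𝔼 3 →L[ℝ] 𝔼 3 := (shearFun N).smulRight e2

/-- `K_N` evaluated. [folklore] -/
theorem shearK_apply (N : 𝔼 3 →L[ℝ] 𝔼 3) (v : 𝔼 3) : shearK N v = shearFun N v • e2 := rfl

/-- `K_N² = 0`. [folklore] -/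
theorem shearK_mul_shearK (N : 𝔼 3 →L[ℝ] 𝔼 3) : shearK N * shearK N = 0 := by
  refine ContinuousLinearMap.ext fun v ↦ ?_
  show shearK N (shearK N v) = 0
  rw [shearK_apply, shearK_apply, map_smul, shearFun_e2, smul_zero, zero_smul]

/-- **The shear `1 - t K_N` is a unit** (inverse `1 + t K_N`). [folklore] -/
theorem isUnit_one_sub_shearK (N : 𝔼 3 →L[ℝ] 𝔼 3) (t : ℝ) : IsUnit (1 - t • shearK N) := by
  have hKK : ∀ v, shearK N (shearK N v) = 0 := fun v ↦ by
    rw [shearK_apply, shearK_apply, map_smul, shearFun_e2, smul_zero, zero_smul]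
  have h1 : (1 - t • shearK N) * (1 + t • shearK N) = 1 := by
    refine ContinuousLinearMap.ext fun v ↦ ?_
    show (v + t • shearK N v) - t • shearK N (v + t • shearK N v) = v
    rw [map_add, map_smul, hKK, smul_zero, add_zero, add_sub_cancel_right]
  have h2 : (1 + t • shearK N) * (1 - t • shearK N) = 1 := by
    refine ContinuousLinearMap.ext fun v ↦ ?_
    show (v - t • shearK N v) + t • shearK N (v - t • shearK N v) = v
    rw [map_sub, map_smul, hKK, smul_zero, sub_zero, sub_add_cancel]
  exact ⟨⟨_, _, h1, h2⟩, rfl⟩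

/-- `N ↦ K_N` is a bounded linear map (hence smooth). [folklore] -/
theorem isBoundedLinearMap_shearK : IsBoundedLinearMap ℝ shearK := by
  have h1 : IsBoundedLinearMap ℝ fun N : 𝔼 3 →L[ℝ] 𝔼 3 ↦ N.comp (1 - P2) :=
    isBoundedBilinearMap_comp.isBoundedLinearMap_left (1 - P2)
  have h2 : IsBoundedLinearMap ℝ fun M : 𝔼 3 →L[ℝ] 𝔼 3 ↦ (innerSL ℝ e2).comp M :=
    isBoundedBilinearMap_comp.isBoundedLinearMap_right (innerSL ℝ e2)
  have h3 : IsBoundedLinearMap ℝ fun φ : 𝔼 3 →L[ℝ] ℝ ↦ φ.smulRight e2 :=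
    isBoundedBilinearMap_smulRight.isBoundedLinearMap_left e2
  exact h3.comp (h2.comp h1)

/-- `N ↦ K_N` is smooth. [folklore] -/
theorem contDiff_shearK : ContDiff ℝ ∞ shearK := isBoundedLinearMap_shearK.contDiff

/-- `P₂ e₀ = 0` for a vector orthogonal to `e₂`: here for `e0`. [folklore] -/
theorem inner_e2_e0 : inner ℝ e2 e0 = (0 : ℝ) := by
  simp [e2, e0, EuclideanSpace.inner_single_left]

/-- `e₁`. [folklore] -/
def e1 : 𝔼 3 := EuclideanSpace.single 1 1

/-- `⟪e₂, e₁⟫ = 0`. [folklore] -/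
theorem inner_e2_e1 : inner ℝ e2 e1 = (0 : ℝ) := by
  simp [e2, e1, EuclideanSpace.inner_single_left]

/-- **Step B₂.** A loop fixing `e₂` is joined to a loop in block form: fixing `e₂` and with
`⟪e₂, M e₀⟫ = ⟪e₂, M e₁⟫ = 0`. [folklore] -/
theorem exists_joined_block (L : OpLoop) (hfix : ∀ u, L.toFun u e2 = e2) :
    ∃ L₁ : OpLoop, Joined L L₁ ∧ ∀ u, L₁.toFun u e2 = e2 ∧ inner ℝ e2 (L₁.toFun u e0) = 0 ∧
      inner ℝ e2 (L₁.toFun u e1) = 0 := by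
  have hK : ContMDiff (𝓡 1) 𝓘(ℝ, 𝔼 3 →L[ℝ] 𝔼 3) ∞ fun u ↦ shearK (L.toFun u) :=
    contDiff_shearK.comp_contMDiff L.contMDiff_toFun
  obtain ⟨L₁, hJ, hL₁⟩ := L.exists_joined_mul_right (D := fun t u ↦ 1 - t • shearK (L.toFun u))
    (fun t ↦ by
      have ht : ContMDiff (𝓡 1) 𝓘(ℝ, ℝ) ∞ fun _ : 𝕊 1 ↦ t := contMDiff_const
      exact contMDiff_const.sub (ht.smul hK))
    (fun t u ↦ isUnit_one_sub_shearK _ _)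
    (continuous_const.sub (continuous_fst.smul
      (contDiff_shearK.continuous.comp (L.contMDiff_toFun.continuous.comp continuous_snd))))
    (fun u ↦ ContinuousLinearMap.ext fun v ↦ by
      show v - (0 : ℝ) • shearK (L.toFun u) v = v
      rw [zero_smul, sub_zero])
  refine ⟨L₁, hJ, fun u ↦ ?_⟩
  have key : ∀ v, L₁.toFun u v = L.toFun u v - shearFun (L.toFun u) v • e2 := fun v ↦ by
    rw [hL₁]
    show L.toFun u (v - (1 : ℝ) • shearK (L.toFun u) v) = _
    rw [one_smul, map_sub, shearK_apply, map_smul, hfix]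
  have hφ : ∀ v, shearFun (L.toFun u) v = inner ℝ e2 (L.toFun u (v - inner ℝ e2 v • e2)) := fun v ↦ rfl
  refine ⟨?_, ?_, ?_⟩
  · rw [key, shearFun_e2, zero_smul, sub_zero, hfix]
  · rw [key, inner_sub_right, real_inner_smul_right, inner_e2_e2, _root_.mul_one, hφ, inner_e2_e0, zero_smul, sub_zero,
      sub_self]
  · rw [key, inner_sub_right, real_inner_smul_right, inner_e2_e2, _root_.mul_one, hφ, inner_e2_e1, zero_smul, sub_zero,
      sub_self]

end StepB


/-! ### Determinants along families and around the circle -/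

/-- The determinant of an operator of `𝔼 3`, through its matrix. [folklore] -/
theorem det_eq_det_toMat (f : 𝔼 3 →L[ℝ] 𝔼 3) : LinearMap.det (f : 𝔼 3 →ₗ[ℝ] 𝔼 3) = (toMat f).det :=
  (det_toMat f).symm

/-- The determinant is continuous on the operators of `𝔼 3`. [folklore] -/
theorem continuous_det_clm : Continuous fun f : 𝔼 3 →L[ℝ] 𝔼 3 ↦ LinearMap.det (f : 𝔼 3 →ₗ[ℝ] 𝔼 3) := by
  simp_rw [det_eq_det_toMat]
  exact (toMat.continuous).matrix_det

/-- **Positivity of the determinant is preserved along a family of loops** (the determinant is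
continuous and nowhere zero on `[0, 1]`). [folklore] -/
theorem Joined.det_pos {L L' : OpLoop} (h : Joined L L') (u : 𝕊 1)
    (hL : 0 < LinearMap.det (L.toFun u : 𝔼 3 →ₗ[ℝ] 𝔼 3)) : 0 < LinearMap.det (L'.toFun u : 𝔼 3 →ₗ[ℝ] 𝔼 3) := by
  obtain ⟨F, hF, -, h0, h1⟩ := h
  set g : ℝ → ℝ := fun t ↦ LinearMap.det ((F t).toFun u : 𝔼 3 →ₗ[ℝ] 𝔼 3) with hg
  have hgc : ContinuousOn g (Icc 0 1) := by
    have h2 : ContinuousOn (fun t : ℝ ↦ (F t).toFun u) (Icc 0 1) :=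
      hF.comp (continuousOn_id.prodMk continuousOn_const) fun t ht ↦ ⟨ht, mem_univ _⟩
    exact continuous_det_clm.comp_continuousOn h2
  have hg0 : 0 < g 0 := by simp only [hg, h0]; exact hL
  by_contra hle
  push Not at hle
  have hg1 : g 1 ≤ 0 := by simp only [hg, h1] at hle ⊢; exact hle
  -- a zero of `g` on `[0, 1]`, contradicting invertibility
  obtain ⟨t, ht, hgt⟩ : ∃ t ∈ Icc (0 : ℝ) 1, g t = 0 :=
    intermediate_value_Icc' zero_le_one hgc ⟨hg1, hg0.le⟩
  exact (F t).det_toFun_ne_zero u hgt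

/-- **A loop with positive determinant at one point has positive determinant everywhere** (the
circle is connected and the determinant never vanishes). [folklore] -/
theorem det_pos_of_det_pos_ptA (L : OpLoop) (hL : 0 < LinearMap.det (L.toFun ptA : 𝔼 3 →ₗ[ℝ] 𝔼 3)) (u : 𝕊 1) :
    0 < LinearMap.det (L.toFun u : 𝔼 3 →ₗ[ℝ] 𝔼 3) := by
  set g : 𝕊 1 → ℝ := fun u ↦ LinearMap.det (L.toFun u : 𝔼 3 →ₗ[ℝ] 𝔼 3) with hg
  have hgc : Continuous g := continuous_det_clm.comp L.contMDiff_toFun.continuous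
  have hpre : IsPreconnected (univ : Set (𝕊 1)) := by
    have hr : 1 < Module.rank ℝ (𝔼 2) := by
      rw [← Module.finrank_eq_rank, finrank_euclideanSpace_fin]; norm_num
    haveI := Subtype.preconnectedSpace (isPreconnected_sphere hr (0 : 𝔼 2) 1)
    exact isPreconnected_univ
  have himg := (hpre.image g hgc.continuousOn)
  rw [image_univ] at himg
  by_contra hle
  push Not at hle
  have h0 : (0 : ℝ) ∈ range g := by
    have hord := himg.ordConnected
    exact hord.out (mem_range_self u) (mem_range_self ptA) ⟨hle, hL.le⟩
  obtain ⟨u₀, hu₀⟩ := h0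
  exact L.det_toFun_ne_zero u₀ hu₀

/-! ### Matrix entries of an operator and the block determinant -/

/-- **The entries of the matrix of an operator**: `toMat f i j = (f e_j) i`. [folklore] -/
theorem toMat_apply_eq (f : 𝔼 3 →L[ℝ] 𝔼 3) (i j : Fin 3) : toMat f i j = f (EuclideanSpace.single j 1) i := by
  have h := congrArg (fun g : 𝔼 3 →L[ℝ] 𝔼 3 ↦ g (EuclideanSpace.single j 1) i) (matCLM_toMat f)
  simp only at h
  rw [← h, matCLM_apply, mulVecE_apply]
  simp

/-- Components through inner products with basis vectors: `v i = ⟪e_i, v⟫`. [folklore] -/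
theorem apply_eq_inner_single (v : 𝔼 3) (i : Fin 3) : v i = inner ℝ (EuclideanSpace.single i (1 : ℝ)) v := by
  rw [EuclideanSpace.inner_single_left]; simp

/-- **The block determinant**: if `f e₂ = e₂` and the `e₂`-components of `f e₀`, `f e₁` vanish,
then `det f = (f e₀)₀ (f e₁)₁ - (f e₀)₁ (f e₁)₀`. [folklore] -/
theorem det_block {f : 𝔼 3 →L[ℝ] 𝔼 3} (h2 : f e2 = e2) (h02 : f e0 2 = 0) (h12 : f e1 2 = 0) :
    LinearMap.det (f : 𝔼 3 →ₗ[ℝ] 𝔼 3) = f e0 0 * f e1 1 - f e0 1 * f e1 0 := by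
  rw [det_eq_det_toMat, Matrix.det_fin_three]
  simp only [toMat_apply_eq]
  have he0 : (EuclideanSpace.single (0 : Fin 3) (1 : ℝ)) = e0 := rfl
  have he1 : (EuclideanSpace.single (1 : Fin 3) (1 : ℝ)) = e1 := rfl
  have he2 : (EuclideanSpace.single (2 : Fin 3) (1 : ℝ)) = e2 := rfl
  rw [he0, he1, he2, h2, h02, h12]
  simp [e2]
  ring


/-! ### Scalings of a coordinate direction and the column shear -/

section Ops

/-- The orthogonal projection onto the unit vector `e`: `v ↦ ⟪e, v⟫ e`. [folklore] -/
def projE (e : 𝔼 3) : 𝔼 3 →L[ℝ] 𝔼 3 := (innerSL ℝ e).smulRight e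

/-- `projE` evaluated. [folklore] -/
theorem projE_apply (e v : 𝔼 3) : projE e v = inner ℝ e v • e := rfl

/-- **The scaling `1 + (c - 1) projE e`**: `e ↦ c e`, identity on `eᗮ`. [folklore] -/
def scaleE (e : 𝔼 3) (c : ℝ) : 𝔼 3 →L[ℝ] 𝔼 3 := 1 + (c - 1) • projE e

/-- `scaleE` evaluated. [folklore] -/
theorem scaleE_apply (e : 𝔼 3) (c : ℝ) (v : 𝔼 3) : scaleE e c v = v + ((c - 1) * inner ℝ e v) • e := by
  simp only [scaleE, mul_smul]
  rfl

variable {e : 𝔼 3} (he : ‖e‖ = 1)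
include he

/-- The scalings multiply. [folklore] -/
theorem scaleE_mul (c c' : ℝ) : scaleE e c * scaleE e c' = scaleE e (c * c') := by
  have hee : inner ℝ e e = (1 : ℝ) := by rw [real_inner_self_eq_norm_sq, he, one_pow]
  refine ContinuousLinearMap.ext fun v ↦ ?_
  show scaleE e c (scaleE e c' v) = scaleE e (c * c') v
  rw [scaleE_apply, scaleE_apply, scaleE_apply, inner_add_right, real_inner_smul_right, hee, _root_.mul_one,
    add_assoc, ← add_smul]
  congr 2
  ring

omit he in
/-- `scaleE e 1 = 1`. [folklore] -/
@[simp] theorem scaleE_one : scaleE e 1 = 1 := by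
  refine ContinuousLinearMap.ext fun v ↦ ?_
  rw [scaleE_apply, sub_self, zero_mul, zero_smul, add_zero]
  rfl

/-- The scaling is a unit for `c ≠ 0`. [folklore] -/
theorem isUnit_scaleE {c : ℝ} (hc : c ≠ 0) : IsUnit (scaleE e c) :=
  ⟨⟨scaleE e c, scaleE e c⁻¹, by rw [scaleE_mul he, mul_inv_cancel₀ hc, scaleE_one],
    by rw [scaleE_mul he, inv_mul_cancel₀ hc, scaleE_one]⟩, rfl⟩

/-- `scaleE e c e = c e`. [folklore] -/
theorem scaleE_self (c : ℝ) : scaleE e c e = c • e := by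
  have hee : inner ℝ e e = (1 : ℝ) := by rw [real_inner_self_eq_norm_sq, he, one_pow]
  rw [scaleE_apply, hee, _root_.mul_one]
  module

omit he in
/-- `scaleE e c v = v` for `v ⊥ e`. [folklore] -/
theorem scaleE_of_inner_eq_zero (c : ℝ) {v : 𝔼 3} (hv : inner ℝ e v = 0) : scaleE e c v = v := by
  rw [scaleE_apply, hv, mul_zero, zero_smul, add_zero]

omit he in
/-- `c ↦ scaleE e c` is smooth (affine). [folklore] -/
theorem contDiff_scaleE : ContDiff ℝ ∞ (scaleE e) := by
  unfold scaleE
  exact contDiff_const.add ((contDiff_id.sub contDiff_const).smul contDiff_const)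

end Ops

/-- **The column shear** `x ↦ s ⟪e₁, x⟫ e₀` (adds `s` times the first column to the second). [folklore] -/
def colShear (s : ℝ) : 𝔼 3 →L[ℝ] 𝔼 3 := s • (innerSL ℝ e1).smulRight e0

/-- The column shear evaluated. [folklore] -/
theorem colShear_apply (s : ℝ) (x : 𝔼 3) : colShear s x = (s * inner ℝ e1 x) • e0 := by
  simp only [colShear, mul_smul]; rfl

/-- `⟪e₁, e₀⟫ = 0`. [folklore] -/
theorem inner_e1_e0 : inner ℝ e1 e0 = (0 : ℝ) := by simp [e1, e0, EuclideanSpace.inner_single_left]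

/-- `⟪e₁, e₁⟫ = 1`. [folklore] -/
theorem inner_e1_e1 : inner ℝ e1 e1 = (1 : ℝ) := by rw [real_inner_self_eq_norm_sq]; simp [e1]

/-- `⟪e₁, e₂⟫ = 0`. [folklore] -/
theorem inner_e1_e2 : inner ℝ e1 e2 = (0 : ℝ) := by simp [e1, e2, EuclideanSpace.inner_single_left]

/-- `⟪e₀, e₁⟫ = 0`. [folklore] -/
theorem inner_e0_e1 : inner ℝ e0 e1 = (0 : ℝ) := by simp [e1, e0, EuclideanSpace.inner_single_left]

/-- `⟪e₀, e₀⟫ = 1`. [folklore] -/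
theorem inner_e0_e0 : inner ℝ e0 e0 = (1 : ℝ) := by rw [real_inner_self_eq_norm_sq]; simp [e0]

/-- The column shear has square zero. [folklore] -/
theorem colShear_colShear (s : ℝ) (x : 𝔼 3) : colShear s (colShear s x) = 0 := by
  rw [colShear_apply, colShear_apply, real_inner_smul_right, inner_e1_e0, mul_zero, mul_zero, zero_smul]

/-- **`1 - t colShear s` is a unit.** [folklore] -/
theorem isUnit_one_sub_colShear (s t : ℝ) : IsUnit (1 - t • colShear s) := by
  have h1 : (1 - t • colShear s) * (1 + t • colShear s) = 1 := by
    refine ContinuousLinearMap.ext fun v ↦ ?_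
    show (v + t • colShear s v) - t • colShear s (v + t • colShear s v) = v
    rw [map_add, map_smul, colShear_colShear, smul_zero, add_zero, add_sub_cancel_right]
  have h2 : (1 + t • colShear s) * (1 - t • colShear s) = 1 := by
    refine ContinuousLinearMap.ext fun v ↦ ?_
    show (v - t • colShear s v) + t • colShear s (v - t • colShear s v) = v
    rw [map_sub, map_smul, colShear_colShear, smul_zero, sub_zero, sub_add_cancel]
  exact ⟨⟨_, _, h1, h2⟩, rfl⟩

/-- `s ↦ colShear s` is smooth (linear). [folklore] -/
theorem contDiff_colShear : ContDiff ℝ ∞ colShear := by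
  unfold colShear; exact contDiff_id.smul contDiff_const

/-! ### Step C — a loop in block form is joined to a rotation loop -/

section StepC

/-- The rotation `J x = (-x₁, x₀, 0)` of the horizontal plane. [folklore] -/
def rot90 (x : 𝔼 3) : 𝔼 3 := !₂[-(x 1), x 0, 0]

/-- `(J x)₀ = -x₁`. [folklore] -/
@[simp] theorem rot90_apply_zero (x : 𝔼 3) : rot90 x 0 = -(x 1) := rfl
/-- `(J x)₁ = x₀`. [folklore] -/
@[simp] theorem rot90_apply_one (x : 𝔼 3) : rot90 x 1 = x 0 := rfl
/-- `(J x)₂ = 0`. [folklore] -/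
@[simp] theorem rot90_apply_two (x : 𝔼 3) : rot90 x 2 = 0 := rfl

/-- The three coordinates of `e₀`, `e₁`, `e₂`. [folklore] -/
theorem e0_apply (i : Fin 3) : e0 i = if i = 0 then 1 else 0 := by
  fin_cases i <;> simp [e0]
/-- The coordinates of `e₁`. [folklore] -/
theorem e1_apply (i : Fin 3) : e1 i = if i = 1 then 1 else 0 := by
  fin_cases i <;> simp [e1]
/-- The coordinates of `e₂`. [folklore] -/
theorem e2_apply (i : Fin 3) : e2 i = if i = 2 then 1 else 0 := by
  fin_cases i <;> simp [e2]

/-- `⟪e₂, v⟫ = v 2`, `⟪e₁, v⟫ = v 1`, `⟪e₀, v⟫ = v 0`. [folklore] -/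
theorem inner_e2_eq (v : 𝔼 3) : inner ℝ e2 v = v 2 := by rw [e2, EuclideanSpace.inner_single_left]; simp
/-- `⟪e₁, v⟫ = v₁`. [folklore] -/
theorem inner_e1_eq (v : 𝔼 3) : inner ℝ e1 v = v 1 := by rw [e1, EuclideanSpace.inner_single_left]; simp
/-- `⟪e₀, v⟫ = v₀`. [folklore] -/
theorem inner_e0_eq (v : 𝔼 3) : inner ℝ e0 v = v 0 := by rw [e0, EuclideanSpace.inner_single_left]; simp

/-- **A horizontal vector orthogonal to a horizontal unit vector `x` is a multiple of `J x`**, the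
multiple being `λ = -x₁ w₀ + x₀ w₁`. [folklore] -/
theorem eq_smul_rot90 {x w : 𝔼 3} (hw2 : w 2 = 0) (hx : x 0 ^ 2 + x 1 ^ 2 = 1)
    (horth : x 0 * w 0 + x 1 * w 1 = 0) : w = (-(x 1) * w 0 + x 0 * w 1) • rot90 x := by
  ext i
  fin_cases i
  · show w 0 = (-(x 1) * w 0 + x 0 * w 1) * (rot90 x 0)
    rw [rot90_apply_zero]; linear_combination (-(w 0)) * hx + x 0 * horth
  · show w 1 = (-(x 1) * w 0 + x 0 * w 1) * (rot90 x 1)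
    rw [rot90_apply_one]; linear_combination (-(w 1)) * hx + x 1 * horth
  · show w 2 = (-(x 1) * w 0 + x 0 * w 1) * (rot90 x 2)
    rw [rot90_apply_two, hw2, mul_zero]

/-- **`rotC` of the unit complex number `x₀ + i x₁` is the operator `e₀ ↦ x, e₁ ↦ J x, e₂ ↦ e₂`**
(for horizontal unit `x`). [folklore] -/
theorem matCLM_rotC_apply_e0 (x : 𝔼 3) (hx2 : x 2 = 0) : matCLM (rotC ⟨x 0, x 1⟩) e0 = x := by
  ext i
  rw [matCLM_apply, mulVecE_apply]
  fin_cases i <;> simp [rotC, e0_apply, hx2]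

/-- `rotC (x₀ + i x₁) e₁ = J x`. [folklore] -/
theorem matCLM_rotC_apply_e1 (x : 𝔼 3) : matCLM (rotC ⟨x 0, x 1⟩) e1 = rot90 x := by
  ext i
  rw [matCLM_apply, mulVecE_apply]
  fin_cases i <;> simp [rotC, e1_apply]

/-- `rotC w e₂ = e₂`. [folklore] -/
theorem matCLM_rotC_apply_e2 (w : ℂ) : matCLM (rotC w) e2 = e2 := by
  ext i
  rw [matCLM_apply, mulVecE_apply]
  fin_cases i <;> simp [rotC, e2_apply]

/-- **Two operators of `𝔼 3` agreeing on `e₀`, `e₁`, `e₂` are equal.** [folklore] -/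
theorem clm_ext_basis {f g : 𝔼 3 →L[ℝ] 𝔼 3} (h0 : f e0 = g e0) (h1 : f e1 = g e1) (h2 : f e2 = g e2) : f = g := by
  refine ContinuousLinearMap.ext fun v ↦ ?_
  have hv : v = v 0 • e0 + v 1 • e1 + v 2 • e2 := by
    ext i
    fin_cases i <;> simp [e0, e1, e2]
  rw [hv]
  simp only [map_add, map_smul, h0, h1, h2]

variable (L : OpLoop)
  (hblock : ∀ u, L.toFun u e2 = e2 ∧ inner ℝ e2 (L.toFun u e0) = 0 ∧ inner ℝ e2 (L.toFun u e1) = 0)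
  (hdet : ∀ u, 0 < LinearMap.det (L.toFun u : 𝔼 3 →ₗ[ℝ] 𝔼 3))

/-- The first column `v(u) = L u e₀`. [folklore] -/
abbrev colV (u : 𝕊 1) : 𝔼 3 := L.toFun u e0

/-- The second column `w(u) = L u e₁`. [folklore] -/
abbrev colW (u : 𝕊 1) : 𝔼 3 := L.toFun u e1

/-- The columns are smooth. [folklore] -/
theorem contMDiff_colV : ContMDiff (𝓡 1) 𝓘(ℝ, 𝔼 3) ∞ L.colV := L.contMDiff_toFun.clm_apply contMDiff_const
/-- The second column is smooth. [folklore] -/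
theorem contMDiff_colW : ContMDiff (𝓡 1) 𝓘(ℝ, 𝔼 3) ∞ L.colW := L.contMDiff_toFun.clm_apply contMDiff_const

/-- The first column never vanishes. [folklore] -/
theorem colV_ne_zero (u : 𝕊 1) : L.colV u ≠ 0 := by
  intro h
  have h1 : L.inv u (L.toFun u e0) = e0 := L.inv_apply_apply u e0
  rw [show L.toFun u e0 = 0 from h, map_zero] at h1
  have : ‖(e0 : 𝔼 3)‖ = 0 := by rw [← h1, norm_zero]
  simp at this

include hblock in
/-- **Step C₁ (orthogonalise the second column).** [folklore] -/
theorem exists_joined_orth :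
    ∃ L₁ : OpLoop, Joined L L₁ ∧ (∀ u, L₁.toFun u e2 = e2 ∧ inner ℝ e2 (L₁.toFun u e0) = 0 ∧
      inner ℝ e2 (L₁.toFun u e1) = 0) ∧ (∀ u, inner ℝ (L₁.toFun u e0) (L₁.toFun u e1) = 0) ∧
      ∀ u, L₁.toFun u e0 = L.toFun u e0 := by
  set sh : 𝕊 1 → ℝ := fun u ↦ inner ℝ (L.colV u) (L.colW u) / ‖L.colV u‖ ^ 2 with hsh
  have hshs : ContMDiff (𝓡 1) 𝓘(ℝ, ℝ) ∞ sh := by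
    have hi : ContMDiff (𝓡 1) 𝓘(ℝ, ℝ) ∞ fun u ↦ inner ℝ (L.colV u) (L.colW u) :=
      (contDiff_inner (𝕜 := ℝ) (E := 𝔼 3)).comp_contMDiff (L.contMDiff_colV.prodMk_space L.contMDiff_colW)
    have hn : ContMDiff (𝓡 1) 𝓘(ℝ, ℝ) ∞ fun u ↦ ‖L.colV u‖ ^ 2 :=
      (contDiff_norm_sq ℝ (n := ∞)).comp_contMDiff L.contMDiff_colV
    exact hi.div₀ hn fun u ↦ pow_ne_zero 2 (norm_ne_zero_iff.2 (L.colV_ne_zero u))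
  obtain ⟨L₁, hJ, hL₁⟩ := L.exists_joined_mul_right (D := fun t u ↦ 1 - t • colShear (sh u))
    (fun t ↦ by
      have ht : ContMDiff (𝓡 1) 𝓘(ℝ, ℝ) ∞ fun _ : 𝕊 1 ↦ t := contMDiff_const
      exact contMDiff_const.sub (ht.smul (contDiff_colShear.comp_contMDiff hshs)))
    (fun t u ↦ isUnit_one_sub_colShear _ _)
    (continuous_const.sub (continuous_fst.smul
      (contDiff_colShear.continuous.comp (hshs.continuous.comp continuous_snd))))
    (fun u ↦ ContinuousLinearMap.ext fun v ↦ by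
      show v - (0 : ℝ) • colShear (sh u) v = v
      rw [zero_smul, sub_zero])
  have key : ∀ u v, L₁.toFun u v = L.toFun u v - (sh u * inner ℝ e1 v) • L.toFun u e0 := fun u v ↦ by
    rw [hL₁]
    show L.toFun u (v - (1 : ℝ) • colShear (sh u) v) = _
    rw [one_smul, map_sub, colShear_apply, map_smul]
  have k0 : ∀ u, L₁.toFun u e0 = L.toFun u e0 := fun u ↦ by
    rw [key, inner_e1_e0, mul_zero, zero_smul, sub_zero]
  have k1 : ∀ u, L₁.toFun u e1 = L.toFun u e1 - sh u • L.toFun u e0 := fun u ↦ by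
    rw [key, inner_e1_e1, _root_.mul_one]
  have k2 : ∀ u, L₁.toFun u e2 = e2 := fun u ↦ by
    rw [key, inner_e1_e2, mul_zero, zero_smul, sub_zero, (hblock u).1]
  refine ⟨L₁, hJ, fun u ↦ ⟨k2 u, ?_, ?_⟩, fun u ↦ ?_, k0⟩
  · rw [k0]; exact (hblock u).2.1
  · rw [k1, inner_sub_right, real_inner_smul_right, (hblock u).2.1, (hblock u).2.2, mul_zero, sub_zero]
  · rw [k0, k1, inner_sub_right, real_inner_smul_right, real_inner_self_eq_norm_sq, hsh]
    simp only
    rw [div_mul_cancel₀ _ (pow_ne_zero 2 (norm_ne_zero_iff.2 (L.colV_ne_zero u))), sub_self]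

include hblock hdet in
/-- **Step C (orthonormalise the horizontal block): a loop in block form with positive
determinant is joined to a rotation loop.** [folklore] -/
theorem exists_joined_rotLoop :
    ∃ (f : 𝕊 1 → ℂ) (hf : ContMDiff (𝓡 1) 𝓘(ℝ, ℂ) ∞ f) (h1 : ∀ u, ‖f u‖ = 1), Joined L (rotLoop f hf h1) := by
  obtain ⟨L₁, hJ₁, hblock₁, horth, hcol⟩ := L.exists_joined_orth hblock
  have hdet₁ : ∀ u, 0 < LinearMap.det (L₁.toFun u : 𝔼 3 →ₗ[ℝ] 𝔼 3) := fun u ↦ hJ₁.det_pos u (hdet u)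
  -- notation
  set v : 𝕊 1 → 𝔼 3 := fun u ↦ L₁.toFun u e0 with hv
  set w : 𝕊 1 → 𝔼 3 := fun u ↦ L₁.toFun u e1 with hw
  have hv0 : ∀ u, v u ≠ 0 := fun u ↦ L₁.colV_ne_zero u
  have hvs : ContMDiff (𝓡 1) 𝓘(ℝ, 𝔼 3) ∞ v := L₁.contMDiff_colV
  have hws : ContMDiff (𝓡 1) 𝓘(ℝ, 𝔼 3) ∞ w := L₁.contMDiff_colW
  have hv2 : ∀ u, v u 2 = 0 := fun u ↦ by rw [← inner_e2_eq]; exact (hblock₁ u).2.1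
  have hw2 : ∀ u, w u 2 = 0 := fun u ↦ by rw [← inner_e2_eq]; exact (hblock₁ u).2.2
  -- the unit first column and the coefficient `λ`
  set x : 𝕊 1 → 𝔼 3 := fun u ↦ ‖v u‖⁻¹ • v u with hx
  have hx2 : ∀ u, x u 2 = 0 := fun u ↦ by simp [hx, hv2 u]
  have hxn : ∀ u, ‖x u‖ = 1 := fun u ↦ by
    rw [hx]; dsimp only; rw [norm_smul, norm_inv, norm_norm, inv_mul_cancel₀ (norm_ne_zero_iff.2 (hv0 u))]
  have hxsq : ∀ u, x u 0 ^ 2 + x u 1 ^ 2 = 1 := fun u ↦ by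
    have h := hxn u
    have h2 : ‖x u‖ ^ 2 = 1 := by rw [h, one_pow]
    rw [EuclideanSpace.real_norm_sq_eq, Fin.sum_univ_three, hx2 u] at h2
    nlinarith [h2]
  have horth' : ∀ u, x u 0 * w u 0 + x u 1 * w u 1 = 0 := fun u ↦ by
    have h := horth u
    have h2 : inner ℝ (x u) (w u) = 0 := by
      rw [hx]; dsimp only; rw [real_inner_smul_left, h, mul_zero]
    rw [EuclideanSpace.inner_eq_star_dotProduct] at h2
    simp [dotProduct, Fin.sum_univ_three, hx2 u] at h2
    linarith [h2]
  set lam : 𝕊 1 → ℝ := fun u ↦ -(x u 1) * w u 0 + x u 0 * w u 1 with hlam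
  have hwlam : ∀ u, w u = lam u • rot90 (x u) := fun u ↦ eq_smul_rot90 (hw2 u) (hxsq u) (horth' u)
  -- `λ > 0` from the determinant
  have hdetv : ∀ u, LinearMap.det (L₁.toFun u : 𝔼 3 →ₗ[ℝ] 𝔼 3) = ‖v u‖ * lam u := fun u ↦ by
    rw [det_block (hblock₁ u).1 (hv2 u) (hw2 u)]
    show v u 0 * w u 1 - v u 1 * w u 0 = ‖v u‖ * lam u
    have hvx : v u = ‖v u‖ • x u := by
      rw [hx]; dsimp only; rw [smul_smul, mul_inv_cancel₀ (norm_ne_zero_iff.2 (hv0 u)), one_smul]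
    have h0 : v u 0 = ‖v u‖ * x u 0 := by
      have := congrArg (fun z : 𝔼 3 ↦ z 0) hvx; simpa using this
    have h1' : v u 1 = ‖v u‖ * x u 1 := by
      have := congrArg (fun z : 𝔼 3 ↦ z 1) hvx; simpa using this
    rw [h0, h1', hlam]; ring
  have hlam0 : ∀ u, 0 < lam u := fun u ↦ by
    have h := hdet₁ u
    rw [hdetv] at h
    exact pos_of_mul_pos_right h (norm_nonneg _) |> fun h' ↦ (pos_iff_pos_of_mul_pos h).1 (norm_pos_iff.2 (hv0 u))
  -- smoothness of the data
  have hxs : ContMDiff (𝓡 1) 𝓘(ℝ, 𝔼 3) ∞ x := by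
    have h1 : ContMDiff (𝓡 1) 𝓘(ℝ, ℝ) ∞ fun u ↦ ‖v u‖⁻¹ := fun u ↦
      (ContDiffAt.comp_contMDiffAt (g := fun v : 𝔼 3 ↦ ‖v‖) (f := v) (contDiffAt_norm ℝ (hv0 u)) (hvs u)).inv₀
        (norm_ne_zero_iff.2 (hv0 u))
    exact h1.smul hvs
  have hcoord : ∀ (g : 𝕊 1 → 𝔼 3), ContMDiff (𝓡 1) 𝓘(ℝ, 𝔼 3) ∞ g → ∀ i, ContMDiff (𝓡 1) 𝓘(ℝ, ℝ) ∞ fun u ↦ g u i :=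
    fun g hg i ↦ (EuclideanSpace.proj (𝕜 := ℝ) i).contDiff.comp_contMDiff hg
  have hlams : ContMDiff (𝓡 1) 𝓘(ℝ, ℝ) ∞ lam :=
    ((hcoord x hxs 1).neg.mul (hcoord w hws 0)).add ((hcoord x hxs 0).mul (hcoord w hws 1))
  -- the clamped coefficients of the column scalings
  set cl : ℝ → ℝ := fun t ↦ max 0 (min t 1) with hcl
  have hcl01 : ∀ t, 0 ≤ cl t ∧ cl t ≤ 1 := fun t ↦ ⟨le_max_left _ _, max_le zero_le_one (min_le_right _ _)⟩
  have hclc : Continuous cl := continuous_const.max (continuous_id.min continuous_const)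
  set α : ℝ → 𝕊 1 → ℝ := fun t u ↦ (1 - cl t) + cl t * ‖v u‖⁻¹ with hα
  set β : ℝ → 𝕊 1 → ℝ := fun t u ↦ (1 - cl t) + cl t * (lam u)⁻¹ with hβ
  have hpos : ∀ {s r : ℝ}, 0 ≤ s → s ≤ 1 → 0 < r → 0 < (1 - s) + s * r := by
    intro s r h0 h1 hr
    have hprod : 0 ≤ s * r := mul_nonneg h0 hr.le
    rcases eq_or_lt_of_le h1 with h | h
    · rw [h] at hprod ⊢; linarith
    · linarith
  have hα0 : ∀ t u, 0 < α t u := fun t u ↦ hpos (hcl01 t).1 (hcl01 t).2 (inv_pos.2 (norm_pos_iff.2 (hv0 u)))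
  have hβ0 : ∀ t u, 0 < β t u := fun t u ↦ hpos (hcl01 t).1 (hcl01 t).2 (inv_pos.2 (hlam0 u))
  have hvn : ContMDiff (𝓡 1) 𝓘(ℝ, ℝ) ∞ fun u ↦ ‖v u‖⁻¹ := fun u ↦
    (ContDiffAt.comp_contMDiffAt (g := fun v : 𝔼 3 ↦ ‖v‖) (f := v) (contDiffAt_norm ℝ (hv0 u)) (hvs u)).inv₀
      (norm_ne_zero_iff.2 (hv0 u))
  have hαs : ∀ t, ContMDiff (𝓡 1) 𝓘(ℝ, ℝ) ∞ (α t) := fun t ↦ contMDiff_const.add (contMDiff_const.mul hvn)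
  have hβs : ∀ t, ContMDiff (𝓡 1) 𝓘(ℝ, ℝ) ∞ (β t) := fun t ↦
    contMDiff_const.add (contMDiff_const.mul (hlams.inv₀ fun u ↦ (hlam0 u).ne'))
  have hαc : Continuous fun p : ℝ × (𝕊 1) ↦ α p.1 p.2 := by
    have h1 : Continuous fun p : ℝ × (𝕊 1) ↦ ‖v p.2‖⁻¹ := hvn.continuous.comp continuous_snd
    have h2 : Continuous fun p : ℝ × (𝕊 1) ↦ cl p.1 := hclc.comp continuous_fst
    exact (continuous_const.sub h2).add (h2.mul h1)
  have hβc : Continuous fun p : ℝ × (𝕊 1) ↦ β p.1 p.2 := by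
    have h1 : Continuous fun p : ℝ × (𝕊 1) ↦ (lam p.2)⁻¹ :=
      (hlams.continuous.comp continuous_snd).inv₀ fun p ↦ (hlam0 p.2).ne'
    have h2 : Continuous fun p : ℝ × (𝕊 1) ↦ cl p.1 := hclc.comp continuous_fst
    exact (continuous_const.sub h2).add (h2.mul h1)
  -- the family `scaleE e0 (α) * scaleE e1 (β)`
  obtain ⟨L₂, hJ₂, hL₂⟩ := L₁.exists_joined_mul_right (D := fun t u ↦ scaleE e0 (α t u) * scaleE e1 (β t u))
    (fun t ↦ (contDiff_mul (𝔸 := 𝔼 3 →L[ℝ] 𝔼 3) (n := ∞)).comp_contMDiff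
      ((contDiff_scaleE.comp_contMDiff (hαs t)).prodMk_space (contDiff_scaleE.comp_contMDiff (hβs t))))
    (fun t u ↦ (isUnit_scaleE norm_e0 (hα0 t u).ne').mul (isUnit_scaleE (by simp [e1]) (hβ0 t u).ne'))
    ((contDiff_scaleE.continuous.comp hαc).mul (contDiff_scaleE.continuous.comp hβc))
    (fun u ↦ by
      have : cl 0 = 0 := by simp [hcl]
      simp only [hα, hβ, this, sub_zero, zero_mul, add_zero, scaleE_one, _root_.mul_one])
  have hcl1 : cl 1 = 1 := by simp [hcl]
  have hα1 : ∀ u, α 1 u = ‖v u‖⁻¹ := fun u ↦ by simp [hα, hcl1]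
  have hβ1 : ∀ u, β 1 u = (lam u)⁻¹ := fun u ↦ by simp [hβ, hcl1]
  -- the columns of `L₂`
  have c0 : ∀ u, L₂.toFun u e0 = x u := fun u ↦ by
    rw [hL₂]
    show L₁.toFun u (scaleE e0 (α 1 u) (scaleE e1 (β 1 u) e0)) = x u
    rw [scaleE_of_inner_eq_zero _ inner_e1_e0, scaleE_self norm_e0, map_smul, hα1]
  have c1 : ∀ u, L₂.toFun u e1 = rot90 (x u) := fun u ↦ by
    rw [hL₂]
    show L₁.toFun u (scaleE e0 (α 1 u) (scaleE e1 (β 1 u) e1)) = rot90 (x u)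
    rw [scaleE_self (by simp [e1]), map_smul, scaleE_of_inner_eq_zero _ inner_e0_e1, map_smul, hβ1]
    show (lam u)⁻¹ • w u = rot90 (x u)
    rw [hwlam, smul_smul, inv_mul_cancel₀ (hlam0 u).ne', one_smul]
  have c2 : ∀ u, L₂.toFun u e2 = e2 := fun u ↦ by
    rw [hL₂]
    show L₁.toFun u (scaleE e0 (α 1 u) (scaleE e1 (β 1 u) e2)) = e2
    rw [scaleE_of_inner_eq_zero _ inner_e1_e2, scaleE_of_inner_eq_zero _ (by rw [inner_e0_eq]; simp [e2]),
      (hblock₁ u).1]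
  -- `L₂` is the rotation loop of `x₀ + i x₁`
  set f : 𝕊 1 → ℂ := fun u ↦ ⟨x u 0, x u 1⟩ with hf
  have hfs : ContMDiff (𝓡 1) 𝓘(ℝ, ℂ) ∞ f := by
    have h := (Complex.equivRealProdCLM.symm.contDiff).comp_contMDiff ((hcoord x hxs 0).prodMk_space (hcoord x hxs 1))
    exact h
  have hf1 : ∀ u, ‖f u‖ = 1 := fun u ↦ by
    rw [Complex.norm_def, Complex.normSq_mk, ← sq, ← sq, hxsq, Real.sqrt_one]
  have heq : L₂ = rotLoop f hfs hf1 := by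
    refine ext' (funext fun u ↦ ?_)
    rw [rotLoop_toFun]
    exact clm_ext_basis (by rw [c0, matCLM_rotC_apply_e0 _ (hx2 u)]) (by rw [c1, matCLM_rotC_apply_e1])
      (by rw [c2, matCLM_rotC_apply_e2])
  exact ⟨f, hfs, hf1, heq ▸ hJ₁.trans hJ₂⟩

end StepC

/-! ### The classification -/

/-- **Gompf–Stipsicz §5.2 (`π₁ SO(3) = ℤ/2`): every smooth loop of orientation-preserving
invertible operators on `ℝ³` is joined — through a continuous family of smooth loops, the
hypothesis of `Literature.Topology.FourManifolds.CircleNbhd.nonempty_diffeomorph_surgered_linTwist_of_family`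
— either to the identity loop or to the twist.**  Hence a circle in a `4`-manifold has at most two
framings up to the equivalence relevant for surgery. [cite: GompfStipsiczGSM1999, §5.2] -/
theorem exists_joined_one_or_twist (L : OpLoop) (hL : 0 < LinearMap.det (L.toFun ptA : 𝔼 3 →ₗ[ℝ] 𝔼 3)) :
    Joined L one ∨ Joined L twist := by
  have hdet := L.det_pos_of_det_pos_ptA hL
  obtain ⟨L₁, hJ₁, hcol₁⟩ := L.exists_joined_col_e2
  have hρ : ContMDiff (𝓡 1) 𝓘(ℝ, ℝ) ∞ fun u ↦ ‖L.col u‖ := fun u ↦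
    ContDiffAt.comp_contMDiffAt (g := fun v : 𝔼 3 ↦ ‖v‖) (f := L.col) (contDiffAt_norm ℝ (L.col_ne_zero u))
      (L.contMDiff_col u)
  obtain ⟨L₂, hJ₂, hfix⟩ := L₁.exists_joined_apply_e2_eq hρ (fun u ↦ norm_pos_iff.2 (L.col_ne_zero u)) hcol₁
  obtain ⟨L₃, hJ₃, hblock⟩ := L₂.exists_joined_block hfix
  have hJ := (hJ₁.trans hJ₂).trans hJ₃
  have hdet₃ : ∀ u, 0 < LinearMap.det (L₃.toFun u : 𝔼 3 →ₗ[ℝ] 𝔼 3) := fun u ↦ hJ.det_pos u (hdet u)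
  obtain ⟨f, hf, h1, hJ₄⟩ := L₃.exists_joined_rotLoop hblock hdet₃
  obtain ⟨d, hJ₅⟩ := exists_joined_rotLoop_twistPow f hf h1
  rcases joined_twistPow d with h | h
  · exact Or.inl ((hJ.trans hJ₄).trans (hJ₅.trans h))
  · exact Or.inr ((hJ.trans hJ₄).trans (hJ₅.trans h))


end OpLoop

/-! ### Consequences for circle surgery: at most two framings -/

namespace CircleNbhd

variable {X : Type u} [TopologicalSpace X] [ChartedSpace (𝔼 4) X] [T2Space X] [IsManifold (𝓡 4) ∞ X]
  {c : 𝕊 1 → X}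

omit [T2Space X] [IsManifold (𝓡 4) ∞ X] in
/-- Reframing by the identity loop gives back the tube (as a structure). [folklore] -/
theorem linTwist_one_eq (ν : CircleNbhd (𝓡 4) c) : ν.linTwist OpLoop.one = ν := by
  cases ν; rfl

/-- **Linear reframings of positive determinant give at most two surgeries**: the surgery along
`ν.linTwist L` is diffeomorphic to the surgery along `ν` or to the surgery along the twisted tube
`ν.linTwist twist`. [cite: GompfStipsiczGSM1999, §5.2] -/
theorem nonempty_diffeomorph_surgered_linTwist_of_det_pos (ν : CircleNbhd (𝓡 4) c) (L : OpLoop)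
    (hL : 0 < LinearMap.det (L.toFun ptA : 𝔼 3 →ₗ[ℝ] 𝔼 3)) :
    Nonempty ((ν.linTwist L).Surgered ≃ₘ⟮𝓡 4, 𝓡 4⟯ ν.Surgered) ∨
      Nonempty ((ν.linTwist L).Surgered ≃ₘ⟮𝓡 4, 𝓡 4⟯ (ν.linTwist OpLoop.twist).Surgered) := by
  rcases L.exists_joined_one_or_twist hL with ⟨F, hF, hFi, h0, h1⟩ | ⟨F, hF, hFi, h0, h1⟩
  · left
    have h := ν.nonempty_diffeomorph_surgered_linTwist_of_family F hF hFi
    rw [h0, h1, linTwist_one_eq] at h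
    exact h
  · right
    have h := ν.nonempty_diffeomorph_surgered_linTwist_of_family F hF hFi
    rw [h0, h1] at h
    exact h

/-- **Any linear reframing gives at most two surgeries** (reflect the fibre first if the
determinant is negative, `OpLoop.exists_det_pos`). [cite: GompfStipsiczGSM1999, §5.2] -/
theorem nonempty_diffeomorph_surgered_linTwist (ν : CircleNbhd (𝓡 4) c) (L : OpLoop) :
    Nonempty ((ν.linTwist L).Surgered ≃ₘ⟮𝓡 4, 𝓡 4⟯ ν.Surgered) ∨
      Nonempty ((ν.linTwist L).Surgered ≃ₘ⟮𝓡 4, 𝓡 4⟯ (ν.linTwist OpLoop.twist).Surgered) := by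
  obtain ⟨L', hL', ⟨e⟩⟩ := OpLoop.exists_det_pos (L := L) ν
  rcases ν.nonempty_diffeomorph_surgered_linTwist_of_det_pos L' hL' with h | h
  · obtain ⟨e'⟩ := h; exact Or.inl ⟨e.trans e'⟩
  · obtain ⟨e'⟩ := h; exact Or.inr ⟨e.trans e'⟩

/-- **A circle in a smooth `4`-manifold has at most two framings, as far as surgery is
concerned** (Gompf–Stipsicz §5.2: *"there are two possible framings, since `π₁(SO(3)) ≅ ℤ₂`"*):
for any two tubular neighbourhoods `ν₀`, `ν` of the same circle, the surgery along `ν` is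
diffeomorphic to the surgery along `ν₀` or to the surgery along the twisted tube `ν₀.linTwist twist`. [cite: GompfStipsiczGSM1999, §5.2] [cite: Kosinski1993, Ch. III §3, Thm (3.1), Thm (3.5)] -/
theorem nonempty_diffeomorph_surgered_or_twist (ν₀ ν : CircleNbhd (𝓡 4) c) :
    Nonempty (ν.Surgered ≃ₘ⟮𝓡 4, 𝓡 4⟯ ν₀.Surgered) ∨
      Nonempty (ν.Surgered ≃ₘ⟮𝓡 4, 𝓡 4⟯ (ν₀.linTwist OpLoop.twist).Surgered) := by
  obtain ⟨L, ⟨e⟩⟩ := CircleNbhd.exists_opLoop_nonempty_diffeomorph_surgered ν₀ ν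
  rcases ν₀.nonempty_diffeomorph_surgered_linTwist L with h | h
  · obtain ⟨e'⟩ := h; exact Or.inl ⟨e.trans e'⟩
  · obtain ⟨e'⟩ := h; exact Or.inr ⟨e.trans e'⟩

end CircleNbhd

end Literature.Topology.FourManifolds
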